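import Literature.Barriers.RiemannHypothesis.TuranPartialSumsWindowBins
import Literature.Barriers.RiemannHypothesis.TuranPartialSumsShiftAbel
import Literature.Barriers.RiemannHypothesis.TuranPartialSumsCriterion
import HarnessLib

/-!
# Sections of `ζ` beyond `σ = 1`: soundness of the window checker, III (the window)

Barrier catalogue `Literature/Barriers/RiemannHypothesis/`, companion of
`TuranPartialSumsWindowCheck.lean` (step U3 of the plan to prove `TuranPartialSums`). From the chunk
soundness (`chunkOut_sound`, `TuranPartialSumsWindowBins.lean`): the combination `sumOuts` of the chunk
outputs bounds the sums over the whole range `(Y', N₁]` (grid cells `i_Y < i ≤ i₁`), cell by cell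
(`CellBounds`, `sumOuts_sound`), with the monotonicity certificate of `|H_k|` on `[2, kcert]`.
Everything here is PROVED.

## References

* [PlattTrudgian2016] D. J. Platt, T. S. Trudgian, LMS J. Comput. Math. 19 (2016), §2.
* [Montgomery1983] H. L. Montgomery, *Zeros of approximations to the zeta function* (1983), §2.
-/

noncomputable section

open Literature.Analysis.ValidatedNumerics.Numerics
open Complex Finset

open scoped Chebyshev

namespace Literature.Barriers.RiemannHypothesis.TuranWindow

/-! ### Cell sums -/

section Cells

variable (P : WinParams) (E : EnvConsts)

/-- Table cells contribute the prime sum of `|H|/p`. [folklore] -/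
def cellR (i : ℕ) : ℝ :=
  if i ≤ E.iX then ∑ p ∈ binPrimes (gridPt (i - 1)) (gridPt i), tabTermR P p else 0

/-- The box cells: prime sums (table) or integer main terms (envelope). [folklore] -/
def cellP (i : ℕ) : ℂ :=
  if i ≤ E.iX then ∑ p ∈ binPrimes (gridPt (i - 1)) (gridPt i), tabTermP P p
  else ∑ n ∈ Finset.Ioc (gridPt (i - 1)) (gridPt i), envTermP P n

/-- Envelope cells: `∑ |H|/(n log n)`. [folklore] -/
def cellm (i : ℕ) : ℝ :=
  if i ≤ E.iX then 0 else ∑ n ∈ Finset.Ioc (gridPt (i - 1)) (gridPt i), envTermm P n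

/-- Envelope cells: `∑ |H|/((n−1) log n)`. [folklore] -/
def cellM (i : ℕ) : ℝ :=
  if i ≤ E.iX then 0 else ∑ n ∈ Finset.Ioc (gridPt (i - 1)) (gridPt i), envTermM P n

/-- Envelope cells: the `R₂` variation. [folklore] -/
def cellR2 (i : ℕ) : ℝ :=
  if i ≤ E.iX then 0 else ∑ n ∈ Finset.Ico (gridPt (i - 1)) (gridPt i), envTermR2 P n

end Cells

/-- `|H|` is nondecreasing on `[2, kc]`. [folklore] -/
def MonoCert (P : WinParams) (kc : ℕ) : Prop := ∀ j, 2 ≤ j → j ≤ kc → ‖Hk P (j - 1)‖ ≤ ‖Hk P j‖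

/-- Bounds of an accumulated output over the cells `lo < i ≤ hi` (reals scaled by `2^48`). [folklore] -/
structure CellBounds (P : WinParams) (E : EnvConsts) (lo hi : ℕ) (o : ChunkOut) : Prop where
  /-- `Rtab ≤ ∑ cellR` -/
  Rtab : (o.Rtab : ℝ) ≤ (∑ i ∈ Finset.Ioc lo hi, cellR P E i) * SC
  /-- `0 ≤ Rtab` -/
  Rtab0 : 0 ≤ o.Rtab
  /-- `P0 ∋ ∑ cellP` -/
  P0 : CB.mem (∑ i ∈ Finset.Ioc lo hi, cellP P E i) o.P0
  /-- `mainm ≤ ∑ cellm` -/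
  mainm : (o.mainm : ℝ) ≤ (∑ i ∈ Finset.Ioc lo hi, cellm P E i) * SC
  /-- `0 ≤ mainm` -/
  mainm0 : 0 ≤ o.mainm
  /-- `∑ cellM ≤ mainM` -/
  mainM : (∑ i ∈ Finset.Ioc lo hi, cellM P E i) * SC ≤ (o.mainM : ℝ)
  /-- `∑ cellR2 ≤ R2` -/
  R2 : (∑ i ∈ Finset.Ioc lo hi, cellR2 P E i) * SC ≤ (o.R2 : ℝ)
  /-- `0 ≤ R2` -/
  R20 : 0 ≤ o.R2
  /-- the transition weight, once the first envelope cell `max(i_X,i_Y)+1` is covered -/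
  GX : lo ≤ max E.iX P.iY → max E.iX P.iY < hi →
    ‖Hk P (kOf P (gridPt (max E.iX P.iY) + 1))‖ / Real.log ((gridPt (max E.iX P.iY) : ℝ) + 1) * SC ≤ (o.GX : ℝ)
  /-- `0 ≤ GX` -/
  GX0 : 0 ≤ o.GX

/-! ### From `AccBounds` (a chunk) to `CellBounds` -/

/-- Union of consecutive cells: `∑_{a<i≤b} ∑_{x ∈ S(g_{i−1}, g_i)} f = ∑_{x ∈ S(g_a, g_b)} f` for the three
kinds of ranges. [folklore] -/
theorem sum_cells_binPrimes {a b : ℕ} (hab : a ≤ b) (f : ℕ → ℝ) :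
    ∑ i ∈ Finset.Ioc a b, ∑ p ∈ binPrimes (gridPt (i - 1)) (gridPt i), f p =
      ∑ p ∈ binPrimes (gridPt a) (gridPt b), f p := by
  induction b, hab using Nat.le_induction with
  | base => simp [binPrimes]
  | succ n hn ih =>
    rw [Finset.sum_Ioc_succ_top (by omega), ih, Nat.add_sub_cancel,
      binPrimes_split (gridPt_strictMono.monotone hn) (gridPt_lt_succ n).le]

/-- [folklore] -/
theorem sum_cells_binPrimes_C {a b : ℕ} (hab : a ≤ b) (f : ℕ → ℂ) :
    ∑ i ∈ Finset.Ioc a b, ∑ p ∈ binPrimes (gridPt (i - 1)) (gridPt i), f p =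
      ∑ p ∈ binPrimes (gridPt a) (gridPt b), f p := by
  induction b, hab using Nat.le_induction with
  | base => simp [binPrimes]
  | succ n hn ih =>
    rw [Finset.sum_Ioc_succ_top (by omega), ih, Nat.add_sub_cancel,
      binPrimes_split (gridPt_strictMono.monotone hn) (gridPt_lt_succ n).le]

/-- [folklore] -/
theorem sum_cells_Ioc {β : Type*} [AddCommMonoid β] {a b : ℕ} (hab : a ≤ b) (f : ℕ → β) :
    ∑ i ∈ Finset.Ioc a b, ∑ n ∈ Finset.Ioc (gridPt (i - 1)) (gridPt i), f n =
      ∑ n ∈ Finset.Ioc (gridPt a) (gridPt b), f n := by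
  induction b, hab using Nat.le_induction with
  | base => simp
  | succ n hn ih =>
    rw [Finset.sum_Ioc_succ_top (by omega), ih, Nat.add_sub_cancel,
      Ioc_split (gridPt_strictMono.monotone hn) (gridPt_lt_succ n).le]

/-- [folklore] -/
theorem sum_cells_Ico {β : Type*} [AddCommMonoid β] {a b : ℕ} (hab : a ≤ b) (f : ℕ → β) :
    ∑ i ∈ Finset.Ioc a b, ∑ n ∈ Finset.Ico (gridPt (i - 1)) (gridPt i), f n =
      ∑ n ∈ Finset.Ico (gridPt a) (gridPt b), f n := by
  induction b, hab using Nat.le_induction with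
  | base => simp
  | succ n hn ih =>
    rw [Finset.sum_Ioc_succ_top (by omega), ih, Nat.add_sub_cancel,
      Ico_split (gridPt_strictMono.monotone hn) (gridPt_lt_succ n).le]

/-- **A chunk's bounds as cell bounds.** [folklore] -/
theorem cellBounds_of_accBounds {P : WinParams} {E : EnvConsts} {top stop : ℕ} {o : ChunkOut}
    (hst : stop < top) (hY : P.iY ≤ stop) (hregion : top ≤ E.iX ∨ E.iX ≤ stop)
    (h : AccBounds P E (decide (top ≤ E.iX)) (gridPt stop) (gridPt top) o) :
    CellBounds P E stop top o := by
  rcases hregion with htab | henv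
  · ---- table chunk: every cell `i ≤ top ≤ iX`
    have hflag : decide (top ≤ E.iX) = true := by simpa using htab
    rw [hflag] at h
    have hcell : ∀ i ∈ Finset.Ioc stop top, i ≤ E.iX := fun i hi ↦ by
      rw [Finset.mem_Ioc] at hi; omega
    have hR : ∑ i ∈ Finset.Ioc stop top, cellR P E i =
        ∑ p ∈ binPrimes (gridPt stop) (gridPt top), tabTermR P p := by
      rw [← sum_cells_binPrimes hst.le]
      exact Finset.sum_congr rfl fun i hi ↦ by simp [cellR, hcell i hi]
    have hP : ∑ i ∈ Finset.Ioc stop top, cellP P E i =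
        ∑ p ∈ binPrimes (gridPt stop) (gridPt top), tabTermP P p := by
      rw [← sum_cells_binPrimes_C hst.le]
      exact Finset.sum_congr rfl fun i hi ↦ by simp [cellP, hcell i hi]
    have hm : ∑ i ∈ Finset.Ioc stop top, cellm P E i = 0 :=
      Finset.sum_eq_zero fun i hi ↦ by simp [cellm, hcell i hi]
    have hM : ∑ i ∈ Finset.Ioc stop top, cellM P E i = 0 :=
      Finset.sum_eq_zero fun i hi ↦ by simp [cellM, hcell i hi]
    have hR2 : ∑ i ∈ Finset.Ioc stop top, cellR2 P E i = 0 :=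
      Finset.sum_eq_zero fun i hi ↦ by simp [cellR2, hcell i hi]
    refine ⟨by rw [hR]; exact h.Rtab rfl, h.Rtab0, by rw [hP]; exact h.P0T rfl,
      by rw [hm, h.mainmT rfl]; simp, h.mainm0, by rw [hM, h.mainMT rfl]; simp,
      by rw [hR2, h.R2T rfl]; simp, h.R20, fun h1 h2 ↦ by omega, h.GX0⟩
  · ---- envelope chunk: every cell `i > stop ≥ iX`
    have hnot : ¬ top ≤ E.iX := by omega
    have hflag : decide (top ≤ E.iX) = false := by simpa using hnot
    rw [hflag] at h
    have hcell : ∀ i ∈ Finset.Ioc stop top, ¬ i ≤ E.iX := fun i hi ↦ by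
      rw [Finset.mem_Ioc] at hi; omega
    have hR : ∑ i ∈ Finset.Ioc stop top, cellR P E i = 0 :=
      Finset.sum_eq_zero fun i hi ↦ by simp [cellR, hcell i hi]
    have hP : ∑ i ∈ Finset.Ioc stop top, cellP P E i =
        ∑ n ∈ Finset.Ioc (gridPt stop) (gridPt top), envTermP P n := by
      rw [← sum_cells_Ioc hst.le]
      exact Finset.sum_congr rfl fun i hi ↦ by simp [cellP, hcell i hi]
    have hm : ∑ i ∈ Finset.Ioc stop top, cellm P E i =
        ∑ n ∈ Finset.Ioc (gridPt stop) (gridPt top), envTermm P n := by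
      rw [← sum_cells_Ioc hst.le]
      exact Finset.sum_congr rfl fun i hi ↦ by simp [cellm, hcell i hi]
    have hM : ∑ i ∈ Finset.Ioc stop top, cellM P E i =
        ∑ n ∈ Finset.Ioc (gridPt stop) (gridPt top), envTermM P n := by
      rw [← sum_cells_Ioc hst.le]
      exact Finset.sum_congr rfl fun i hi ↦ by simp [cellM, hcell i hi]
    have hR2 : ∑ i ∈ Finset.Ioc stop top, cellR2 P E i =
        ∑ n ∈ Finset.Ico (gridPt stop) (gridPt top), envTermR2 P n := by
      rw [← sum_cells_Ico hst.le]
      exact Finset.sum_congr rfl fun i hi ↦ by simp [cellR2, hcell i hi]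
    refine ⟨by rw [hR, h.RtabE rfl]; simp, h.Rtab0, by rw [hP]; exact h.P0E rfl,
      by rw [hm]; exact h.mainm rfl, h.mainm0, by rw [hM]; exact h.mainM rfl,
      by rw [hR2]; exact h.R2 rfl, h.R20, fun h1 h2 ↦ ?_, h.GX0⟩
    -- the transition cell belongs to this chunk iff `stop = max iX iY`
    have hmax : max E.iX P.iY = stop := le_antisymm (max_le henv hY) h1
    rw [hmax]
    exact h.GX rfl (by rw [hmax]) (gridPt_strictMono hst)

/-! ### Additivity and the fold -/

/-- Adjacent cell bounds add up under `sumOuts`' step. [folklore] -/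
theorem cellBounds_add {P : WinParams} {E : EnvConsts} {a b c : ℕ} {acc o : ChunkOut}
    (hab : a ≤ b) (hbc : b ≤ c) (hacc : CellBounds P E b c acc) (ho : CellBounds P E a b o)
    (mono : Bool) (kc : ℕ) :
    CellBounds P E a c ⟨acc.ok && o.ok, acc.Rtab + o.Rtab, acc.mainm + o.mainm, acc.mainM + o.mainM,
      acc.R2 + o.R2, acc.P0.add o.P0, max acc.maxco o.maxco, max acc.GX o.GX, mono, kc⟩ := by
  have hR : ∑ i ∈ Finset.Ioc a c, cellR P E i =
      ∑ i ∈ Finset.Ioc b c, cellR P E i + ∑ i ∈ Finset.Ioc a b, cellR P E i := by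
    rw [Ioc_split hab hbc, add_comm]
  have hP : ∑ i ∈ Finset.Ioc a c, cellP P E i =
      ∑ i ∈ Finset.Ioc b c, cellP P E i + ∑ i ∈ Finset.Ioc a b, cellP P E i := by
    rw [Ioc_split hab hbc, add_comm]
  have hm : ∑ i ∈ Finset.Ioc a c, cellm P E i =
      ∑ i ∈ Finset.Ioc b c, cellm P E i + ∑ i ∈ Finset.Ioc a b, cellm P E i := by
    rw [Ioc_split hab hbc, add_comm]
  have hM : ∑ i ∈ Finset.Ioc a c, cellM P E i =
      ∑ i ∈ Finset.Ioc b c, cellM P E i + ∑ i ∈ Finset.Ioc a b, cellM P E i := by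
    rw [Ioc_split hab hbc, add_comm]
  have hR2 : ∑ i ∈ Finset.Ioc a c, cellR2 P E i =
      ∑ i ∈ Finset.Ioc b c, cellR2 P E i + ∑ i ∈ Finset.Ioc a b, cellR2 P E i := by
    rw [Ioc_split hab hbc, add_comm]
  refine ⟨?_, add_nonneg hacc.Rtab0 ho.Rtab0, ?_, ?_, add_nonneg hacc.mainm0 ho.mainm0, ?_, ?_,
    add_nonneg hacc.R20 ho.R20, fun h1 h2 ↦ ?_, le_trans hacc.GX0 (le_max_left _ _)⟩
  · push_cast; rw [hR, add_mul]; exact add_le_add hacc.Rtab ho.Rtab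
  · show CB.mem _ (acc.P0.add o.P0)
    rw [hP]; exact CB.mem_add hacc.P0 ho.P0
  · push_cast; rw [hm, add_mul]; exact add_le_add hacc.mainm ho.mainm
  · push_cast; rw [hM, add_mul]; exact add_le_add hacc.mainM ho.mainM
  · push_cast; rw [hR2, add_mul]; exact add_le_add hacc.R2 ho.R2
  · push_cast
    rcases lt_or_ge (max E.iX P.iY) b with hlt | hge
    · exact (ho.GX h1 hlt).trans (by exact_mod_cast le_max_right _ _)
    · exact (hacc.GX hge h2).trans (by exact_mod_cast le_max_left _ _)

/-- Empty cell bounds. [folklore] -/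
theorem cellBounds_empty {P : WinParams} {E : EnvConsts} (a : ℕ) (mono : Bool) (kc : ℕ) :
    CellBounds P E a a ⟨true, 0, 0, 0, 0, CB.ofInt 0, 0, 0, mono, kc⟩ := by
  refine ⟨by simp, le_rfl, ?_, by simp, le_rfl, by simp, by simp, le_rfl, fun h1 h2 ↦ by omega, le_rfl⟩
  rw [Finset.Ioc_self, Finset.sum_empty]; exact_mod_cast CB.mem_ofInt 0

/-- `MonoCert` is downward closed. [folklore] -/
theorem MonoCert.mono {P : WinParams} {a b : ℕ} (h : MonoCert P b) (hab : a ≤ b) : MonoCert P a :=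
  fun j h1 h2 ↦ h j h1 (h2.trans hab)

/-- The invariant of the fold `sumOuts` after the chunks `< c` have been consumed: the accumulator
bounds the cells `(s_c, s_0]` (`s = splits`), its flags are sound, and the monotonicity certificate
covers `[2, kcert]` (and, while all chunks so far were monotone, the whole frontier
`[2, ⌊N₁/g_{s_c}⌋]`, with `kcert` not beyond it). [folklore] -/
structure FoldInv (P : WinParams) (E : EnvConsts) (c : ℕ) (acc : ChunkOut) : Prop where
  /-- the boundaries decrease -/
  decr : P.splits.getD c 0 ≤ P.splits.getD 0 0
  /-- bounds over the consumed cells -/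
  cells : CellBounds P E (P.splits.getD c 0) (P.splits.getD 0 0) acc
  /-- all consumed chunks passed -/
  ok : acc.ok = true
  /-- the certificate -/
  mono : MonoCert P acc.kcert
  /-- the frontier, while everything is monotone -/
  front : acc.allMono = true →
    acc.kcert ≤ N1Of P / gridPt (P.splits.getD c 0) ∧ MonoCert P (N1Of P / gridPt (P.splits.getD c 0))

/-- The initial accumulator of `sumOuts`. [folklore] -/
theorem foldInv_init (P : WinParams) (E : EnvConsts) (h0 : P.splits.getD 0 0 = P.i1) :
    FoldInv P E 0 ⟨true, 0, 0, 0, 0, CB.ofInt 0, 0, 0, true, 0⟩ := by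
  refine ⟨le_rfl, cellBounds_empty _ _ _, rfl, fun j h1 h2 ↦ by simp at h2; omega, fun _ ↦ ⟨Nat.zero_le _, ?_⟩⟩
  intro j h1 h2
  rw [h0] at h2
  unfold N1Of at h2
  rw [Nat.div_self (gridPt_pos _)] at h2
  omega

/-- **The fold.** If every chunk `c < m` passes (`outs[c] = chunkOut P E piTab c`) and the window
hypotheses hold, then `sumOuts` bounds all cells `(s_m, s_0]` and certifies monotonicity on
`[2, kcert]`. [folklore] -/
theorem sumOuts_sound {P : WinParams} {E : EnvConsts} {piTab : List ℕ} (W : WinCtx P E piTab)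
    (outs : List ChunkOut)
    (houts : ∀ c, c < outs.length → outs.getD c ChunkOut.fail = chunkOut P E piTab c)
    (hok : ∀ c, c < outs.length → (chunkOut P E piTab c).ok = true) :
    ∀ (c : ℕ) (rest : List ChunkOut) (acc : ChunkOut), rest = outs.drop c → FoldInv P E c acc →
      FoldInv P E (c + rest.length) (sumOuts rest acc)
  | c, [], acc, _, hinv => by simpa [sumOuts] using hinv
  | c, o :: rest, acc, hrest, hinv => by
    rw [sumOuts]
    have hc : c < outs.length := by
      by_contra hge
      push Not at hge
      rw [List.drop_eq_nil_of_le hge] at hrest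
      simp at hrest
    have ho : o = chunkOut P E piTab c := by
      have h1 : (outs.drop c).getD 0 ChunkOut.fail = o := by rw [← hrest]; rfl
      rw [List.getD_eq_getElem?_getD, List.getElem?_drop, Nat.add_zero, ← List.getD_eq_getElem?_getD] at h1
      rw [← h1, houts c hc]
    have hrest' : rest = outs.drop (c + 1) := by
      have : (outs.drop c).tail = rest := by rw [← hrest]; rfl
      rw [← this, List.tail_drop]
    obtain ⟨-, hsound⟩ := chunkOut_sound (E := E) (piTab := piTab) (c := c) W.td_pos (hok c hc)
    obtain ⟨hts, hti1, hsY, hacc⟩ := hsound W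
    have hregion : P.splits.getD c 0 ≤ E.iX ∨ E.iX ≤ P.splits.getD (c + 1) 0 := by
      have hok' := hok c hc
      unfold chunkOut at hok'
      split at hok'
      · simp [ChunkOut.fail] at hok'
      · rename_i tab Ψ0 st0 hinit
        unfold chunkInit at hinit
        simp only at hinit
        cases hg : chunkGuard P E piTab c
        · obtain ⟨-, -, -, -, -, -, hr⟩ := chunkGuard_false hg
          rcases hr with ⟨h1, -⟩ | h2
          · exact Or.inl h1
          · exact Or.inr h2
        · rw [hg] at hinit; simp at hinit
    have hcellc : CellBounds P E (P.splits.getD (c + 1) 0) (P.splits.getD c 0) o := by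
      rw [ho]; exact cellBounds_of_accBounds hts hsY hregion hacc
    rw [← ho] at hacc
    have hoOK : o.ok = true := by rw [ho]; exact hok c hc
    -- frontier arithmetic
    have hfront_le : N1Of P / gridPt (P.splits.getD c 0) ≤ N1Of P / gridPt (P.splits.getD (c + 1) 0) :=
      Nat.div_le_div_left (gridPt_strictMono.monotone hts.le) (gridPt_pos _)
    -- the new certificate
    have hnewcert : acc.allMono = true → o.allMono = true →
        MonoCert P (N1Of P / gridPt (P.splits.getD (c + 1) 0)) := by
      intro ha hb j h1 h2
      obtain ⟨-, hfm⟩ := hinv.front ha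
      rcases le_or_gt j (N1Of P / gridPt (P.splits.getD c 0)) with hle | hgt
      · exact hfm j h1 hle
      · rcases le_or_gt j P.k0 with hjk | hjk
        · exact hacc.monoTab hb (by omega) j h1 hjk
        · exact hacc.mono hb j hgt hjk (by rw [← hacc.kcert]; rw [hacc.kcert]; exact h2)
    -- apply the induction hypothesis
    have := sumOuts_sound W outs houts hok (c + 1) rest
      ⟨acc.ok && o.ok, acc.Rtab + o.Rtab, acc.mainm + o.mainm, acc.mainM + o.mainM, acc.R2 + o.R2,
        acc.P0.add o.P0, max acc.maxco o.maxco, max acc.GX o.GX, acc.allMono && o.allMono,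
        bif acc.allMono && o.allMono then max acc.kcert o.kcert else acc.kcert⟩ hrest' ?_
    · rw [show c + (o :: rest).length = c + 1 + rest.length by simp; ring]
      exact this
    · refine ⟨by have := hinv.decr; omega,
        cellBounds_add hts.le hinv.decr hinv.cells hcellc _ _, by simp [hinv.ok, hoOK], ?_, ?_⟩
      · -- mono
        show MonoCert P (bif (acc.allMono && o.allMono) then max acc.kcert o.kcert else acc.kcert)
        cases hm : (acc.allMono && o.allMono)
        · simpa using hinv.mono
        · simp only [Bool.cond_true]
          rw [Bool.and_eq_true] at hm
          have hcert := hnewcert hm.1 hm.2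
          refine hcert.mono (max_le ?_ ?_)
          · exact (hinv.front hm.1).1.trans hfront_le
          · rw [hacc.kcert]
      · -- front
        intro hm
        simp only at hm
        rw [hm]
        simp only [Bool.cond_true]
        rw [Bool.and_eq_true] at hm
        refine ⟨max_le ((hinv.front hm.1).1.trans hfront_le) (by rw [hacc.kcert]), hnewcert hm.1 hm.2⟩

/-! ### The envelope hypothesis (Chebyshev's `θ` = Mathlib's `Chebyshev.theta`) -/

/-- **Envelope hypothesis** `α n ≤ θ(n) ≤ β n` for integers `n ≥ X = g_{i_X}` (`α = an/ed`,
`β = bn/ed`); discharged by an explicit Chebyshev estimate. [folklore] -/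
def EnvHyp (E : EnvConsts) : Prop :=
  ∀ n : ℕ, gridPt E.iX ≤ n →
    (E.an : ℝ) / E.ed * n ≤ θ (n : ℝ) ∧ θ (n : ℝ) ≤ (E.bn : ℝ) / E.ed * n

/-! ### Prime sums as `θ`-weighted integer sums (summation by parts is `TuranShift.abel_Ioc`) -/

/-- A prime sum over `(a, b]` as a `θ`-weighted integer sum: `∑_p f p = ∑_n (θ n − θ(n−1))·(f n / log n)`
(`1 ≤ a`). [folklore] -/
theorem sum_binPrimes_eq_theta {R : Type*} [Field R] [Algebra ℝ R] (f : ℕ → ℝ) {a b : ℕ} (ha : 1 ≤ a) :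
    ∑ p ∈ binPrimes a b, f p =
      ∑ n ∈ Finset.Ioc a b, (θ (n : ℝ) - θ ((n - 1 : ℕ) : ℝ)) * (f n / Real.log n) := by
  unfold binPrimes
  rw [Finset.sum_filter]
  refine Finset.sum_congr rfl fun n hn ↦ ?_
  rw [Finset.mem_Ioc] at hn
  rw [TuranShift.theta_natCast_sub_theta (by omega)]
  split_ifs with hp
  · have h2 : (2 : ℝ) ≤ n := by exact_mod_cast hp.two_le
    have hlog : Real.log n ≠ 0 := (Real.log_pos (by linarith)).ne'
    field_simp
  · simp

/-- Complex version. [folklore] -/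
theorem sum_binPrimes_eq_theta_C (f : ℕ → ℂ) {a b : ℕ} (ha : 1 ≤ a) :
    ∑ p ∈ binPrimes a b, f p =
      ∑ n ∈ Finset.Ioc a b, ((θ (n : ℝ) - θ ((n - 1 : ℕ) : ℝ) : ℝ) : ℂ) * (f n / (Real.log n : ℂ)) := by
  unfold binPrimes
  rw [Finset.sum_filter]
  refine Finset.sum_congr rfl fun n hn ↦ ?_
  rw [Finset.mem_Ioc] at hn
  rw [TuranShift.theta_natCast_sub_theta (by omega)]
  split_ifs with hp
  · have h2 : (2 : ℝ) ≤ n := by exact_mod_cast hp.two_le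
    have hlog : (Real.log n : ℂ) ≠ 0 := by
      exact_mod_cast (Real.log_pos (by linarith)).ne'
    field_simp
  · simp

/-! ### The envelope lower bound for `R` -/

/-- **Lower bound.** For `w ≥ 0` on `(a, b]`, `αn ≤ θ(n) ≤ βn` on `[a, b]` (`0 ≤ α ≤ β`), `a < b`:
`∑_{p∈(a,b]} w(p) log p ≥ α ∑_{a<n≤b} w(n) − (β−α)(a·w(a+1) + ∑_{a<n<b} n·(w(n+1) − w(n))⁺)`. [folklore] -/
theorem envelope_lower {w : ℕ → ℝ} {α β : ℝ} {a b : ℕ} (hab : a < b)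
    (hαβ : α ≤ β) (hw : ∀ n, a < n → n ≤ b → 0 ≤ w n)
    (hθ : ∀ n, a ≤ n → n ≤ b → α * n ≤ θ (n : ℝ) ∧ θ (n : ℝ) ≤ β * n) :
    α * ∑ n ∈ Finset.Ioc a b, w n -
        (β - α) * (a * w (a + 1) + ∑ n ∈ Finset.Ico (a + 1) b, n * max (w (n + 1) - w n) 0) ≤
      ∑ n ∈ Finset.Ioc a b, (θ (n : ℝ) - θ ((n - 1 : ℕ) : ℝ)) * w n := by
  -- both sums by parts
  have h1 := TuranShift.abel_Ioc (fun n : ℕ ↦ θ (n : ℝ)) w hab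
  beta_reduce at h1
  have h2 := TuranShift.abel_Ioc (fun n : ℕ ↦ (n : ℝ)) w hab
  beta_reduce at h2
  have hsumw : ∑ n ∈ Finset.Ioc a b, w n = ∑ n ∈ Finset.Ioc a b, ((n : ℝ) - ((n - 1 : ℕ) : ℝ)) * w n := by
    refine Finset.sum_congr rfl fun n hn ↦ ?_
    rw [Finset.mem_Ioc] at hn
    rw [Nat.cast_sub (by omega)]; ring
  rw [hsumw, h2, h1]
  -- termwise comparison
  have hb := hθ b hab.le le_rfl
  have haa := hθ a le_rfl hab.le
  have hwb : 0 ≤ w b := hw b hab le_rfl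
  have hwa : 0 ≤ w (a + 1) := hw (a + 1) (by omega) (by omega)
  have hsum : ∑ n ∈ Finset.Ico (a + 1) b, θ (n : ℝ) * (w (n + 1) - w n) ≤
      ∑ n ∈ Finset.Ico (a + 1) b, (α * (n * (w (n + 1) - w n)) + (β - α) * (n * max (w (n + 1) - w n) 0)) := by
    refine Finset.sum_le_sum fun n hn ↦ ?_
    rw [Finset.mem_Ico] at hn
    obtain ⟨hlo, hhi⟩ := hθ n (by omega) (by omega)
    have hn0 : (0 : ℝ) ≤ n := Nat.cast_nonneg _
    have hβα : 0 ≤ β - α := sub_nonneg.2 hαβ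
    rcases le_or_gt 0 (w (n + 1) - w n) with hx | hx
    · rw [max_eq_left hx]
      have := mul_le_mul_of_nonneg_right hlo hx
      have h3 : 0 ≤ (β - α) * (n * (w (n + 1) - w n)) := mul_nonneg hβα (mul_nonneg hn0 hx)
      nlinarith
    · rw [max_eq_right hx.le, mul_zero, mul_zero, add_zero]
      have := mul_le_mul_of_nonpos_right hhi hx.le
      nlinarith
  rw [Finset.sum_add_distrib, ← Finset.mul_sum, ← Finset.mul_sum] at hsum
  have e1 : α * b * w b ≤ θ (b : ℝ) * w b := mul_le_mul_of_nonneg_right hb.1 hwb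
  have e2 : θ (a : ℝ) * w (a + 1) ≤ β * a * w (a + 1) := mul_le_mul_of_nonneg_right haa.2 hwa
  nlinarith [e1, e2, hsum]

/-! ### The envelope error for complex sums -/

/-- **Error bound.** For complex `w` on `(a, b]` and `|θ(n) − n| ≤ η n` on `[a, b]`, `a < b`:
`‖∑_n (θ n − θ(n−1)) w n − ∑_n w n‖ ≤ η (b‖w b‖ + a‖w (a+1)‖ + ∑_{a<n<b} n‖w(n+1) − w n‖)`. [folklore] -/
theorem envelope_error {w : ℕ → ℂ} {η : ℝ} {a b : ℕ} (hab : a < b)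
    (hθ : ∀ n, a ≤ n → n ≤ b → |θ (n : ℝ) - n| ≤ η * n) :
    ‖∑ n ∈ Finset.Ioc a b, ((θ (n : ℝ) - θ ((n - 1 : ℕ) : ℝ) : ℝ) : ℂ) * w n - ∑ n ∈ Finset.Ioc a b, w n‖ ≤
      η * (b * ‖w b‖ + a * ‖w (a + 1)‖ + ∑ n ∈ Finset.Ico (a + 1) b, n * ‖w (n + 1) - w n‖) := by
  have hη : 0 ≤ η := by
    have := hθ b hab.le le_rfl
    have hb0 : (0 : ℝ) < b := by exact_mod_cast (show 0 < b by omega)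
    nlinarith [abs_nonneg (θ (b : ℝ) - b)]
  -- `r(n) = θ(n) − n` as a complex-valued sequence
  set r : ℕ → ℂ := fun n ↦ ((θ (n : ℝ) - n : ℝ) : ℂ) with hr
  have hdiff : ∀ n ∈ Finset.Ioc a b, ((θ (n : ℝ) - θ ((n - 1 : ℕ) : ℝ) : ℝ) : ℂ) * w n - w n =
      (r n - r (n - 1)) * w n := by
    intro n hn
    rw [Finset.mem_Ioc] at hn
    simp only [hr]
    push_cast
    simp only [Nat.cast_sub (show 1 ≤ n by omega), Nat.cast_one]
    ring
  rw [← Finset.sum_sub_distrib, Finset.sum_congr rfl hdiff, TuranShift.abel_Ioc r w hab]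
  have hrn : ∀ n, a ≤ n → n ≤ b → ‖r n‖ ≤ η * n := fun n h1 h2 ↦ by
    simp only [hr, Complex.norm_real, Real.norm_eq_abs]; exact hθ n h1 h2
  refine (norm_sub_le _ _).trans ?_
  refine (add_le_add (norm_sub_le _ _) (norm_sum_le _ _)).trans ?_
  rw [norm_mul, norm_mul]
  have h1 : ‖r b‖ * ‖w b‖ ≤ η * b * ‖w b‖ :=
    mul_le_mul_of_nonneg_right (by nlinarith [hrn b hab.le le_rfl]) (norm_nonneg _)
  have h2 : ‖r a‖ * ‖w (a + 1)‖ ≤ η * a * ‖w (a + 1)‖ :=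
    mul_le_mul_of_nonneg_right (by nlinarith [hrn a le_rfl hab.le]) (norm_nonneg _)
  have h3 : ∑ n ∈ Finset.Ico (a + 1) b, ‖r n * (w (n + 1) - w n)‖ ≤
      ∑ n ∈ Finset.Ico (a + 1) b, η * (n * ‖w (n + 1) - w n‖) := by
    refine Finset.sum_le_sum fun n hn ↦ ?_
    rw [Finset.mem_Ico] at hn
    rw [norm_mul]
    have := hrn n (by omega) (by omega)
    nlinarith [norm_nonneg (w (n + 1) - w n)]
  rw [← Finset.mul_sum] at h3
  nlinarith

/-! ### Jumps of `k(n) = ⌊N₁/n⌋`: reindexing by `m` -/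

/-- The variation of `H_{k(n)}` at the step `n → n+1` is supported on the `m` with `n = ⌊N₁/m⌋`:
`‖H_{k(n+1)} − H_{k(n)}‖ ≤ ∑_{m : ⌊N₁/m⌋ = n, m > kc} 1/m` when `|H|` is monotone up to `kc`
(only the first `‖H_{k(n)}‖ − ‖H_{k(n+1)}‖`-type use needs positivity; here the plain norm of the
difference is bounded without `kc`). [folklore] -/
theorem norm_Hk_step_le (P : WinParams) (n : ℕ) (hn : 0 < n) :
    ‖Hk P (kOf P (n + 1)) - Hk P (kOf P n)‖ ≤
      ∑ m ∈ (Finset.Ioc (kOf P (n + 1)) (kOf P n)), ((m : ℝ))⁻¹ := by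
  have hle : kOf P (n + 1) ≤ kOf P n := Nat.div_le_div_left (Nat.le_succ n) hn
  rw [norm_sub_rev]
  exact norm_zetaPartialSum_sub_le_sum (sOf_re _) hle

/-- `m ∈ (k(n+1), k(n)]` iff `⌊N₁/m⌋ = n` (for `0 < n`, `0 < m`). [folklore] -/
theorem mem_Ioc_kOf_iff (P : WinParams) {n m : ℕ} (hn : 0 < n) (hm : 0 < m) :
    m ∈ Finset.Ioc (kOf P (n + 1)) (kOf P n) ↔ N1Of P / m = n := by
  unfold kOf
  rw [Finset.mem_Ioc, Nat.div_lt_iff_lt_mul (by omega), Nat.le_div_iff_mul_le hn]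
  constructor
  · rintro ⟨h1, h2⟩
    apply le_antisymm
    · exact Nat.lt_succ_iff.1 ((Nat.div_lt_iff_lt_mul hm).2 (by rw [Nat.mul_comm]; exact h1))
    · exact (Nat.le_div_iff_mul_le hm).2 (by rw [Nat.mul_comm]; exact h2)
  · intro h
    rw [← h]
    refine ⟨?_, Nat.mul_div_le _ _⟩
    have := Nat.lt_div_mul_add (a := N1Of P) hm
    rw [Nat.mul_add, Nat.mul_one, Nat.mul_comm]
    exact this

/-- **Reindexing.** For nonnegative weights `c n` and any `g : ℕ → ℝ≥0`-valued summand: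
`∑_{a<n<b} c n · ∑_{m ∈ (k(n+1), k(n)], Q m} 1/m ≤ ∑_{m ∈ [2, k(a+1)], Q m} c(⌊N₁/m⌋)/m`
(`b = N₁`, `1 ≤ a`). [folklore] -/
theorem sum_jumps_reindex (P : WinParams) {a : ℕ} (ha : 1 ≤ a) (c : ℕ → ℝ)
    (hc : ∀ n, 0 ≤ c n) (Q : ℕ → Prop) [DecidablePred Q] :
    ∑ n ∈ Finset.Ico (a + 1) (N1Of P),
        c n * ∑ m ∈ (Finset.Ioc (kOf P (n + 1)) (kOf P n)).filter Q, ((m : ℝ))⁻¹ ≤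
      ∑ m ∈ (Finset.Icc 2 (kOf P (a + 1))).filter Q, c (N1Of P / m) * ((m : ℝ))⁻¹ := by
  -- write the left side as a sum over pairs and regroup by `m`
  rw [Finset.sum_congr rfl fun n _ ↦ Finset.mul_sum _ _ _]
  rw [Finset.sum_sigma']
  -- the map `(n, m) ↦ m` is injective on the index set and lands in the right set
  refine le_of_eq_of_le ?_ (Finset.sum_le_sum_of_subset_of_nonneg (f := fun m ↦ c (N1Of P / m) * ((m : ℝ))⁻¹)
    (s := ((Finset.Ico (a + 1) (N1Of P)).sigma fun n ↦
      (Finset.Ioc (kOf P (n + 1)) (kOf P n)).filter Q).image (fun x ↦ x.2)) ?_ ?_)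
  · rw [Finset.sum_image]
    · refine Finset.sum_congr rfl fun x hx ↦ ?_
      rw [Finset.mem_sigma, Finset.mem_filter, Finset.mem_Ico] at hx
      obtain ⟨⟨h1, h2⟩, hm, -⟩ := hx
      have hm0 : 0 < x.2 := by rw [Finset.mem_Ioc] at hm; omega
      rw [(mem_Ioc_kOf_iff P (by omega) hm0).1 hm]
    · intro x hx y hy hxy
      rw [Finset.mem_coe, Finset.mem_sigma, Finset.mem_filter, Finset.mem_Ico] at hx hy
      have hx0 : 0 < x.2 := by have := hx.2.1; rw [Finset.mem_Ioc] at this; omega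
      have hy0 : 0 < y.2 := by have := hy.2.1; rw [Finset.mem_Ioc] at this; omega
      have h1 := (mem_Ioc_kOf_iff P (by omega) hx0).1 hx.2.1
      have h2 := (mem_Ioc_kOf_iff P (by omega) hy0).1 hy.2.1
      simp only at hxy
      rw [hxy] at h1
      exact Sigma.ext (by rw [← h1, ← h2]) (heq_of_eq hxy)
  · intro m hm
    rw [Finset.mem_image] at hm
    obtain ⟨x, hx, rfl⟩ := hm
    rw [Finset.mem_sigma, Finset.mem_filter, Finset.mem_Ico] at hx
    obtain ⟨⟨h1, h2⟩, hm, hq⟩ := hx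
    rw [Finset.mem_filter, Finset.mem_Icc]
    refine ⟨⟨?_, ?_⟩, hq⟩
    · -- `m ≥ 2`: `m = 1` would give `n = N₁`
      have hm0 : 0 < x.2 := by rw [Finset.mem_Ioc] at hm; omega
      have heq := (mem_Ioc_kOf_iff P (by omega) hm0).1 hm
      by_contra hlt
      have : x.2 = 1 := by omega
      rw [this, Nat.div_one] at heq
      omega
    · rw [Finset.mem_Ioc] at hm
      exact hm.2.trans (Nat.div_le_div_left (by omega) (by omega))
  · intro m _ _
    exact mul_nonneg (hc _) (inv_nonneg.2 (Nat.cast_nonneg _))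

/-! ### Monotone chains and the jump weights -/

/-- A chain of monotone steps. [folklore] -/
theorem MonoCert.chain {P : WinParams} {kc : ℕ} (h : MonoCert P kc) {i j : ℕ} (hi : 1 ≤ i) (hij : i ≤ j)
    (hj : j ≤ kc) : ‖Hk P i‖ ≤ ‖Hk P j‖ := by
  induction j, hij using Nat.le_induction with
  | base => exact le_rfl
  | succ m hm ih =>
    exact (ih (by omega)).trans (by simpa using h (m + 1) (by omega) hj)

/-- The positive variation of `|H_{k(·)}|` at a step, beyond the certificate:
`(‖H_{k(n+1)}‖ − ‖H_{k(n)}‖)⁺ ≤ ∑_{m ∈ (k(n+1), k(n)], m > kc} 1/m`. [folklore] -/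
theorem posPart_norm_step_le {P : WinParams} {kc : ℕ} (hmono : MonoCert P kc) {n : ℕ} (hn : 0 < n) :
    max (‖Hk P (kOf P (n + 1))‖ - ‖Hk P (kOf P n)‖) 0 ≤
      ∑ m ∈ (Finset.Ioc (kOf P (n + 1)) (kOf P n)).filter (fun m ↦ kc < m), ((m : ℝ))⁻¹ := by
  set k' := kOf P (n + 1)
  set k := kOf P n
  have hle : k' ≤ k := Nat.div_le_div_left (Nat.le_succ n) hn
  have hS0 : 0 ≤ ∑ m ∈ (Finset.Ioc k' k).filter (fun m ↦ kc < m), ((m : ℝ))⁻¹ :=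
    Finset.sum_nonneg fun m _ ↦ by positivity
  refine max_le ?_ hS0
  rcases Nat.eq_zero_or_pos k' with hk0 | hk0
  · -- `k' = 0`: then `H_{k'} = 0`
    have : Hk P k' = 0 := by rw [hk0]; simp [Hk, zetaPartialSum]
    rw [this, norm_zero, zero_sub]
    exact le_trans (neg_nonpos.2 (norm_nonneg _)) hS0
  -- `j = max k' kc ⊓ k`
  set j := min (max k' kc) k with hj
  have hk'j : k' ≤ j := le_min (le_max_left _ _) hle
  have hjk : j ≤ k := min_le_right _ _
  have h1 : ‖Hk P k'‖ ≤ ‖Hk P j‖ := by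
    rcases le_or_gt k' kc with hkc | hkc
    · exact hmono.chain hk0 hk'j (by simp [hj]; omega)
    · have : j = k' := by simp [hj]; omega
      rw [this]
  have h2 : ‖Hk P j‖ - ‖Hk P k‖ ≤ ∑ m ∈ Finset.Ioc j k, ((m : ℝ))⁻¹ := by
    have := norm_zetaPartialSum_sub_le_sum (sOf_re (τOf P)) hjk
    have h' := norm_sub_norm_le (Hk P j) (Hk P k)
    rw [← norm_sub_rev] at h'
    exact h'.trans (by simpa [Hk] using this)
  have h3 : ∑ m ∈ Finset.Ioc j k, ((m : ℝ))⁻¹ ≤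
      ∑ m ∈ (Finset.Ioc k' k).filter (fun m ↦ kc < m), ((m : ℝ))⁻¹ := by
    refine Finset.sum_le_sum_of_subset_of_nonneg (fun m hm ↦ ?_) (fun _ _ _ ↦ by positivity)
    rw [Finset.mem_Ioc] at hm
    rw [Finset.mem_filter, Finset.mem_Ioc]
    simp only [hj] at hm
    omega
  linarith

/-- The real jump weight: `J(Q) = ∑_{m ∈ [2, K], Q m} (1/m)/log ⌊N₁/m⌋`. [folklore] -/
def jumpReal (P : WinParams) (K : ℕ) (Q : ℕ → Prop) [DecidablePred Q] : ℝ :=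
  ∑ m ∈ (Finset.Icc 2 K).filter Q, (1 / Real.log ((N1Of P / m : ℕ) : ℝ)) * ((m : ℝ))⁻¹

/-- Monotonicity of `jumpReal` in `K`. [folklore] -/
theorem jumpReal_mono (P : WinParams) {K K' : ℕ} (h : K ≤ K') (Q : ℕ → Prop) [DecidablePred Q] :
    jumpReal P K Q ≤ jumpReal P K' Q := by
  unfold jumpReal
  refine Finset.sum_le_sum_of_subset_of_nonneg ?_ (fun m _ _ ↦ ?_)
  · intro m hm
    rw [Finset.mem_filter, Finset.mem_Icc] at hm ⊢
    exact ⟨⟨hm.1.1, hm.1.2.trans h⟩, hm.2⟩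
  · apply mul_nonneg _ (by positivity)
    apply div_nonneg zero_le_one
    exact Real.log_natCast_nonneg _

/-! ### The envelope range: `R` from below -/

section Envelope

variable {P : WinParams} {E : EnvConsts}

/-- `|H|/p / log p = |H|/(p log p)`. [folklore] -/
theorem tabTermR_div_log (P : WinParams) (n : ℕ) : tabTermR P n / Real.log n = envTermm P n := by
  unfold tabTermR envTermm
  rw [div_div]

/-- **`R` over the envelope range.** With `a = g_{max(i_X,i_Y)} < N₁`, the envelope hypothesis, and
the monotonicity certificate on `[2, kc]`:
`∑_{p ∈ (a, N₁]} |H_{k(p)}|/p ≥ α·∑_{a<n≤N₁} |H_{k(n)}|/(n log n) − (β−α)(G + J⁺)`,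
`G = |H_{k(a+1)}|/log(a+1)`, `J⁺ = jumpReal (· > kc)` up to `K ≥ k(a+1)`. [folklore] -/
theorem envelope_R_lower (hEnv : EnvHyp E) {a : ℕ} (haX : gridPt E.iX ≤ a) (ha2 : 2 ≤ a)
    (hab : a < N1Of P) {kc K : ℕ} (hmono : MonoCert P kc) (hK : kOf P (a + 1) ≤ K)
    (hαβ : E.an ≤ E.bn) (hed : 0 < E.ed) :
    (E.an : ℝ) / E.ed * ∑ n ∈ Finset.Ioc a (N1Of P), envTermm P n -
        ((E.bn : ℝ) / E.ed - E.an / E.ed) *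
          (‖Hk P (kOf P (a + 1))‖ / Real.log ((a : ℝ) + 1) + jumpReal P K (fun m ↦ kc < m)) ≤
      ∑ p ∈ binPrimes a (N1Of P), tabTermR P p := by
  set α : ℝ := (E.an : ℝ) / E.ed
  set β : ℝ := (E.bn : ℝ) / E.ed
  have hαβ' : α ≤ β := div_le_div_of_nonneg_right (by exact_mod_cast hαβ) (by exact_mod_cast hed.le)
  rw [sum_binPrimes_eq_theta (R := ℝ) (tabTermR P) (by omega)]
  simp_rw [tabTermR_div_log]
  have hw : ∀ n, a < n → n ≤ N1Of P → 0 ≤ envTermm P n := fun n _ _ ↦ by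
    unfold envTermm
    apply div_nonneg (norm_nonneg _)
    exact mul_nonneg (Nat.cast_nonneg _) (Real.log_natCast_nonneg _)
  have hθ : ∀ n, a ≤ n → n ≤ N1Of P → α * n ≤ θ (n : ℝ) ∧ θ (n : ℝ) ≤ β * n := fun n h1 _ ↦
    hEnv n (haX.trans h1)
  refine le_trans ?_ (envelope_lower hab hαβ' hw hθ)
  -- compare the two correction terms
  have hβα : 0 ≤ β - α := sub_nonneg.2 hαβ'
  have ha0 : (0 : ℝ) < a := by exact_mod_cast (show 0 < a by omega)
  have hloga1 : 0 < Real.log ((a : ℝ) + 1) := Real.log_pos (by linarith)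
  -- (i) `a·w(a+1) ≤ G`
  have hG : (a : ℝ) * envTermm P (a + 1) ≤ ‖Hk P (kOf P (a + 1))‖ / Real.log ((a : ℝ) + 1) := by
    unfold envTermm
    push_cast
    rw [mul_div_assoc', div_le_div_iff₀ (by positivity) hloga1]
    have := norm_nonneg (Hk P (kOf P (a + 1)))
    nlinarith [mul_nonneg this hloga1.le]
  -- (ii) `V⁺ ≤ J⁺`
  have hV : ∑ n ∈ Finset.Ico (a + 1) (N1Of P), (n : ℝ) * max (envTermm P (n + 1) - envTermm P n) 0 ≤
      jumpReal P K (fun m ↦ kc < m) := by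
    have hstep : ∀ n ∈ Finset.Ico (a + 1) (N1Of P),
        (n : ℝ) * max (envTermm P (n + 1) - envTermm P n) 0 ≤
          (1 / Real.log n) * ∑ m ∈ (Finset.Ioc (kOf P (n + 1)) (kOf P n)).filter (fun m ↦ kc < m),
            ((m : ℝ))⁻¹ := by
      intro n hn
      rw [Finset.mem_Ico] at hn
      have hn2 : (2 : ℝ) < n := by
        have : (a : ℝ) + 1 ≤ n := by exact_mod_cast hn.1
        have : (2 : ℝ) ≤ a := by exact_mod_cast ha2
        linarith
      have hlogn : 0 < Real.log n := Real.log_pos (by linarith)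
      have hlogn1 : Real.log n ≤ Real.log ((n : ℝ) + 1) := Real.log_le_log (by linarith) (by linarith)
      -- `w(n+1) − w(n) ≤ c (x − y)` with `c = 1/(n log n)`
      set x := ‖Hk P (kOf P (n + 1))‖
      set y := ‖Hk P (kOf P n)‖
      have hx0 : 0 ≤ x := norm_nonneg _
      have hc : envTermm P (n + 1) - envTermm P n ≤ (1 / ((n : ℝ) * Real.log n)) * (x - y) := by
        unfold envTermm
        push_cast
        have hc' : x / (((n : ℝ) + 1) * Real.log ((n : ℝ) + 1)) ≤ x / ((n : ℝ) * Real.log n) := by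
          apply div_le_div_of_nonneg_left hx0 (by positivity)
          exact mul_le_mul (by linarith) hlogn1 hlogn.le (by linarith)
        rw [mul_sub, one_div_mul_eq_div, one_div_mul_eq_div]
        linarith
      have hpp : max (envTermm P (n + 1) - envTermm P n) 0 ≤ (1 / ((n : ℝ) * Real.log n)) * max (x - y) 0 := by
        refine max_le ?_ (mul_nonneg (by positivity) (le_max_right _ _))
        exact hc.trans (mul_le_mul_of_nonneg_left (le_max_left _ _) (by positivity))
      calc (n : ℝ) * max (envTermm P (n + 1) - envTermm P n) 0
          ≤ (n : ℝ) * ((1 / ((n : ℝ) * Real.log n)) * max (x - y) 0) :=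
            mul_le_mul_of_nonneg_left hpp (by linarith)
        _ = (1 / Real.log n) * max (x - y) 0 := by field_simp
        _ ≤ (1 / Real.log n) * _ :=
            mul_le_mul_of_nonneg_left (posPart_norm_step_le hmono (by omega)) (by positivity)
    refine (Finset.sum_le_sum hstep).trans ?_
    refine (sum_jumps_reindex P (a := a) (by omega) (fun n ↦ 1 / Real.log n)
      (fun n ↦ div_nonneg zero_le_one (Real.log_natCast_nonneg n)) (fun m ↦ kc < m)).trans ?_
    unfold jumpReal
    refine Finset.sum_le_sum_of_subset_of_nonneg ?_ (fun m _ _ ↦ ?_)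
    · intro m hm
      rw [Finset.mem_filter, Finset.mem_Icc] at hm ⊢
      exact ⟨⟨hm.1.1, hm.1.2.trans hK⟩, hm.2⟩
    · exact mul_nonneg (div_nonneg zero_le_one (Real.log_natCast_nonneg _)) (by positivity)
  nlinarith [mul_le_mul_of_nonneg_left (add_le_add hG hV) hβα]

/-! ### The envelope range: the error of `P₀` -/

/-- `‖envTermP n‖ = envTermm n`. [folklore] -/
theorem norm_envTermP (P : WinParams) {n : ℕ} (hn : 0 < n) : ‖envTermP P n‖ = envTermm P n := by
  unfold envTermP envTermm
  rw [norm_div, norm_mul, Complex.norm_real, Real.norm_eq_abs, abs_of_nonneg (Real.log_natCast_nonneg n)]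
  have := norm_ofReal_cpow_neg (sOf_re (τOf P)) (show (0 : ℝ) < (n : ℝ) by exact_mod_cast hn)
  rw [show ((n : ℝ) : ℂ) = (n : ℂ) by norm_cast] at this
  rw [this, inv_mul_eq_div, div_div]

/-- `H_1 = 1`. [folklore] -/
theorem Hk_one (P : WinParams) : Hk P 1 = 1 := by
  simp [Hk, zetaPartialSum]

/-- The step of `w = envTermP`: `n‖w(n+1) − w(n)‖ ≤ |s|·M(n+1) + R₂(n) + ‖H_{k(n+1)} − H_{k(n)}‖/log n`
(`n ≥ 2`). [folklore] -/
theorem envTermP_step_le (P : WinParams) {n : ℕ} (hn : 2 ≤ n) :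
    (n : ℝ) * ‖envTermP P (n + 1) - envTermP P n‖ ≤
      ‖sOf (τOf P)‖ * envTermM P (n + 1) + envTermR2 P n +
        ‖Hk P (kOf P (n + 1)) - Hk P (kOf P n)‖ / Real.log n := by
  set s := sOf (τOf P)
  set H' := Hk P (kOf P (n + 1))
  set H := Hk P (kOf P n)
  have hn0 : (0 : ℝ) < n := by exact_mod_cast (show 0 < n by omega)
  have hn2 : (2 : ℝ) ≤ n := by exact_mod_cast hn
  have hlogn : 0 < Real.log n := Real.log_pos (by linarith)
  have hlogn1 : 0 < Real.log ((n : ℝ) + 1) := Real.log_pos (by linarith)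
  have hlogle : Real.log n ≤ Real.log ((n : ℝ) + 1) := Real.log_le_log hn0 (by linarith)
  -- the three pieces
  have hdecomp : envTermP P (n + 1) - envTermP P n =
      (((n + 1 : ℕ) : ℂ) ^ (-s) - (n : ℂ) ^ (-s)) * H' / (Real.log ((n + 1 : ℕ) : ℝ) : ℂ) +
      (n : ℂ) ^ (-s) * H' * (1 / (Real.log ((n + 1 : ℕ) : ℝ) : ℂ) - 1 / (Real.log n : ℂ)) +
      (n : ℂ) ^ (-s) * (H' - H) / (Real.log n : ℂ) := by
    unfold envTermP
    have h1 : (Real.log n : ℂ) ≠ 0 := by exact_mod_cast hlogn.ne'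
    have h2 : (Real.log ((n + 1 : ℕ) : ℝ) : ℂ) ≠ 0 := by
      push_cast
      exact_mod_cast hlogn1.ne'
    field_simp
    ring
  have hns : ‖(n : ℂ) ^ (-s)‖ = ((n : ℝ))⁻¹ := by
    have := norm_ofReal_cpow_neg (sOf_re (τOf P)) hn0
    rw [show ((n : ℝ) : ℂ) = (n : ℂ) by norm_cast] at this
    exact this
  have hdiff : ‖((n + 1 : ℕ) : ℂ) ^ (-s) - (n : ℂ) ^ (-s)‖ ≤ ‖s‖ * ((n : ℝ))⁻¹ ^ 2 := by
    have := norm_cpow_neg_sub_cpow_neg_le (sOf_re (τOf P)) (c := n) (d := (n : ℝ) + 1)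
      (by linarith) (x := n) (y := (n : ℝ) + 1) ⟨le_rfl, by linarith⟩ ⟨by linarith, le_rfl⟩
    push_cast at this ⊢
    simpa using this
  have hlog1 : ‖(Real.log ((n + 1 : ℕ) : ℝ) : ℂ)‖ = Real.log ((n : ℝ) + 1) := by
    push_cast
    rw [show ((Real.log ((n : ℝ) + 1) : ℝ) : ℂ) = ((Real.log ((n : ℝ) + 1) : ℝ) : ℂ) by norm_cast]
    rw [Complex.norm_real, Real.norm_eq_abs, abs_of_pos hlogn1]
  have hlog0 : ‖(Real.log n : ℂ)‖ = Real.log n := by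
    rw [Complex.norm_real, Real.norm_eq_abs, abs_of_pos hlogn]
  have hinvlog : ‖1 / (Real.log ((n + 1 : ℕ) : ℝ) : ℂ) - 1 / (Real.log n : ℂ)‖ =
      1 / Real.log n - 1 / Real.log ((n : ℝ) + 1) := by
    have : (1 / (Real.log ((n + 1 : ℕ) : ℝ) : ℂ) - 1 / (Real.log n : ℂ)) =
        ((1 / Real.log ((n : ℝ) + 1) - 1 / Real.log n : ℝ) : ℂ) := by push_cast; ring
    rw [this, Complex.norm_real, Real.norm_eq_abs, abs_of_nonpos (by
      have := one_div_le_one_div_of_le hlogn hlogle; linarith)]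
    ring
  rw [hdecomp]
  refine (mul_le_mul_of_nonneg_left ((norm_add_le _ _).trans (add_le_add (norm_add_le _ _) le_rfl))
    hn0.le).trans ?_
  rw [norm_div, norm_mul, norm_mul, norm_mul, norm_div, norm_mul, hns, hlog1, hlog0, hinvlog]
  -- compare termwise
  have hH' : 0 ≤ ‖H'‖ := norm_nonneg _
  have t1' : ‖s‖ * (‖H'‖ / ((n : ℝ) * Real.log ((n : ℝ) + 1))) = ‖s‖ * envTermM P (n + 1) := by
    unfold envTermM
    push_cast
    rw [show ((n : ℝ) + 1 - 1) = n by ring]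
  have t1 : (n : ℝ) * (‖((n + 1 : ℕ) : ℂ) ^ (-s) - (n : ℂ) ^ (-s)‖ * ‖H'‖ / Real.log ((n : ℝ) + 1)) ≤
      ‖s‖ * envTermM P (n + 1) := by
    rw [← t1']
    calc (n : ℝ) * (‖((n + 1 : ℕ) : ℂ) ^ (-s) - (n : ℂ) ^ (-s)‖ * ‖H'‖ / Real.log ((n : ℝ) + 1))
        ≤ (n : ℝ) * (‖s‖ * ((n : ℝ))⁻¹ ^ 2 * ‖H'‖ / Real.log ((n : ℝ) + 1)) := by gcongr
      _ = ‖s‖ * (‖H'‖ / ((n : ℝ) * Real.log ((n : ℝ) + 1))) := by field_simp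
  have t2 : (n : ℝ) * (((n : ℝ))⁻¹ * ‖H'‖ * (1 / Real.log n - 1 / Real.log ((n : ℝ) + 1))) = envTermR2 P n := by
    unfold envTermR2
    field_simp
    ring
  have t3 : (n : ℝ) * (((n : ℝ))⁻¹ * ‖H' - H‖ / Real.log n) = ‖H' - H‖ / Real.log n := by
    field_simp
  nlinarith [t1, t2, t3]

/-- **`P₀` over the envelope range.** With `a = g_{max(i_X,i_Y)}`, `2 ≤ a < N₁`, the envelope
hypothesis (`η = max(1−α, β−1)`):
`‖∑_{p∈(a,N₁]} p^{-s}H_{k(p)} − ∑_{a<n≤N₁} n^{-s}H_{k(n)}/log n‖ ≤ η(1/log N₁ + G + |s|·∑ M + ∑ R₂ + J_all)`.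
[folklore] -/
theorem envelope_P_error (hEnv : EnvHyp E) {a : ℕ} (haX : gridPt E.iX ≤ a) (ha2 : 2 ≤ a)
    (hab : a < N1Of P) {K : ℕ} (hK : kOf P (a + 1) ≤ K) :
    ‖∑ p ∈ binPrimes a (N1Of P), tabTermP P p - ∑ n ∈ Finset.Ioc a (N1Of P), envTermP P n‖ ≤
      max (1 - (E.an : ℝ) / E.ed) ((E.bn : ℝ) / E.ed - 1) *
        (1 / Real.log (N1Of P) + ‖Hk P (kOf P (a + 1))‖ / Real.log ((a : ℝ) + 1) +
          ‖sOf (τOf P)‖ * ∑ n ∈ Finset.Ioc a (N1Of P), envTermM P n +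
          ∑ n ∈ Finset.Ico a (N1Of P), envTermR2 P n + jumpReal P K (fun _ ↦ True)) := by
  set η : ℝ := max (1 - (E.an : ℝ) / E.ed) ((E.bn : ℝ) / E.ed - 1)
  set b := N1Of P with hbdef
  have hθ : ∀ n, a ≤ n → n ≤ b → |θ (n : ℝ) - n| ≤ η * n := by
    intro n h1 _
    obtain ⟨hlo, hhi⟩ := hEnv n (haX.trans h1)
    have hn0 : (0 : ℝ) ≤ n := Nat.cast_nonneg _
    rw [abs_le]
    constructor
    · have : (1 - (E.an : ℝ) / E.ed) * n ≤ η * n := mul_le_mul_of_nonneg_right (le_max_left _ _) hn0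
      nlinarith
    · have : ((E.bn : ℝ) / E.ed - 1) * n ≤ η * n := mul_le_mul_of_nonneg_right (le_max_right _ _) hn0
      nlinarith
  have hη0 : 0 ≤ η := by
    have := hθ a le_rfl hab.le
    have ha0 : (0 : ℝ) < a := by exact_mod_cast (show 0 < a by omega)
    nlinarith [abs_nonneg (θ (a : ℝ) - a)]
  -- rewrite the prime sum
  have hps : ∑ p ∈ binPrimes a b, tabTermP P p =
      ∑ n ∈ Finset.Ioc a b, ((θ (n : ℝ) - θ ((n - 1 : ℕ) : ℝ) : ℝ) : ℂ) * envTermP P n := by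
    rw [sum_binPrimes_eq_theta_C (tabTermP P) (by omega)]
    rfl
  rw [hps]
  refine (envelope_error hab hθ).trans (mul_le_mul_of_nonneg_left ?_ hη0)
  -- the boundary terms
  have hb1 : (b : ℝ) * ‖envTermP P b‖ = 1 / Real.log b := by
    rw [norm_envTermP P (by omega)]
    unfold envTermm kOf
    rw [← hbdef, Nat.div_self (by omega), Hk_one, norm_one]
    have hb0 : (0 : ℝ) < b := by exact_mod_cast (show 0 < b by omega)
    field_simp
  have ha0 : (0 : ℝ) < a := by exact_mod_cast (show 0 < a by omega)
  have hloga1 : 0 < Real.log ((a : ℝ) + 1) := Real.log_pos (by linarith)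
  have hb2 : (a : ℝ) * ‖envTermP P (a + 1)‖ ≤ ‖Hk P (kOf P (a + 1))‖ / Real.log ((a : ℝ) + 1) := by
    rw [norm_envTermP P (by omega)]
    unfold envTermm
    push_cast
    rw [mul_div_assoc', div_le_div_iff₀ (by positivity) hloga1]
    have := norm_nonneg (Hk P (kOf P (a + 1)))
    nlinarith [mul_nonneg this hloga1.le]
  -- the variation
  have hvar : ∑ n ∈ Finset.Ico (a + 1) b, (n : ℝ) * ‖envTermP P (n + 1) - envTermP P n‖ ≤
      ‖sOf (τOf P)‖ * ∑ n ∈ Finset.Ioc a b, envTermM P n + ∑ n ∈ Finset.Ico a b, envTermR2 P n +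
        jumpReal P K (fun _ ↦ True) := by
    have hstep := fun n (hn : n ∈ Finset.Ico (a + 1) b) ↦
      envTermP_step_le P (n := n) (by rw [Finset.mem_Ico] at hn; omega)
    refine (Finset.sum_le_sum hstep).trans ?_
    rw [Finset.sum_add_distrib, Finset.sum_add_distrib, ← Finset.mul_sum]
    refine add_le_add (add_le_add ?_ ?_) ?_
    · -- `M`: shift the index
      refine mul_le_mul_of_nonneg_left ?_ (norm_nonneg _)
      have hMnn : ∀ i ∈ Finset.Ioc a b, 0 ≤ envTermM P i := fun i hi ↦ by
        rw [Finset.mem_Ioc] at hi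
        unfold envTermM
        apply div_nonneg (norm_nonneg _) (mul_nonneg _ (Real.log_natCast_nonneg _))
        have : (1 : ℝ) ≤ i := by exact_mod_cast (show 1 ≤ i by omega)
        linarith
      calc ∑ n ∈ Finset.Ico (a + 1) b, envTermM P (n + 1)
          = ∑ n ∈ Finset.Ioc (a + 1) b, envTermM P n := by
            rw [Finset.sum_Ico_add', Finset.Ico_add_one_add_one_eq_Ioc]
        _ ≤ ∑ n ∈ Finset.Ioc a b, envTermM P n :=
            Finset.sum_le_sum_of_subset_of_nonneg (Finset.Ioc_subset_Ioc_left (by omega)) fun i hi _ ↦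
              hMnn i hi
    · refine Finset.sum_le_sum_of_subset_of_nonneg (Finset.Ico_subset_Ico_left (by omega)) fun i hi _ ↦ ?_
      rw [Finset.mem_Ico] at hi
      unfold envTermR2
      apply mul_nonneg (norm_nonneg _)
      have hi2 : (2 : ℝ) ≤ i := by exact_mod_cast (show 2 ≤ i by omega)
      have hlogi : 0 < Real.log i := Real.log_pos (by linarith)
      have := one_div_le_one_div_of_le hlogi (Real.log_le_log (by linarith) (by linarith : (i : ℝ) ≤ i + 1))
      linarith
    · -- the jumps
      have hj : ∀ n ∈ Finset.Ico (a + 1) b, ‖Hk P (kOf P (n + 1)) - Hk P (kOf P n)‖ / Real.log n ≤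
          (1 / Real.log n) * ∑ m ∈ (Finset.Ioc (kOf P (n + 1)) (kOf P n)).filter (fun _ ↦ True),
            ((m : ℝ))⁻¹ := by
        intro n hn
        rw [Finset.mem_Ico] at hn
        rw [Finset.filter_true_of_mem (fun _ _ ↦ trivial), div_eq_mul_one_div, mul_comm]
        exact mul_le_mul_of_nonneg_left (norm_Hk_step_le P n (by omega))
          (div_nonneg zero_le_one (Real.log_natCast_nonneg _))
      refine (Finset.sum_le_sum hj).trans ?_
      refine (sum_jumps_reindex P (a := a) (by omega) (fun n ↦ 1 / Real.log n)
        (fun n ↦ div_nonneg zero_le_one (Real.log_natCast_nonneg n)) (fun _ ↦ True)).trans ?_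
      unfold jumpReal
      refine Finset.sum_le_sum_of_subset_of_nonneg ?_ (fun m _ _ ↦ ?_)
      · intro m hm
        rw [Finset.mem_filter, Finset.mem_Icc] at hm ⊢
        exact ⟨⟨hm.1.1, hm.1.2.trans hK⟩, trivial⟩
      · exact mul_nonneg (div_nonneg zero_le_one (Real.log_natCast_nonneg _)) (by positivity)
  rw [hb1] 
  linarith [hb2, hvar]

end Envelope

/-! ### Soundness of the jump sums `jumpGo` / `jumpSum` -/

/-- The real jump weight from `k` on: `∑_{m ∈ [k, K], Q m} (1/log⌊N₁/m⌋)/m`. [folklore] -/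
def jumpRealFrom (P : WinParams) (K k : ℕ) (Q : ℕ → Prop) [DecidablePred Q] : ℝ :=
  ∑ m ∈ (Finset.Ico k (K + 1)).filter Q, (1 / Real.log ((N1Of P / m : ℕ) : ℝ)) * ((m : ℝ))⁻¹

/-- **`jumpGo`.** `jumpGo N₁ K kcert all fuel k acc = some J` implies
`acc + 2^48·∑_{m∈[k,K], all ∨ m>kcert} (1/log⌊N₁/m⌋)/m ≤ J` (`1 ≤ k`). [folklore] -/
theorem jumpGo_sound (P : WinParams) (K kcert : ℕ) (all : Bool) :
    ∀ (fuel k : ℕ) (acc J : ℤ), jumpGo (N1Of P) K kcert all fuel k acc = some J → 1 ≤ k →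
      (acc : ℝ) + jumpRealFrom P K k (fun m ↦ all = true ∨ kcert < m) * SC ≤ (J : ℝ)
  | 0, k, acc, J, h, _ => by simp [jumpGo] at h
  | fuel + 1, k, acc, J, h, hk => by
    rw [jumpGo] at h
    cases hK : Nat.blt K k
    · rw [hK] at h
      simp only [Bool.cond_false] at h
      have hkK : k ≤ K := le_of_blt_false hK
      set k' := min (K + 1) (k + max 1 (k / 4)) with hk'def
      have hkk' : k < k' := by
        simp only [hk'def, lt_min_iff]; omega
      have hk'K : k' ≤ K + 1 := min_le_left _ _
      -- split the weight at `k'`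
      have hsplit : jumpRealFrom P K k (fun m ↦ all = true ∨ kcert < m) =
          ∑ m ∈ (Finset.Ico k k').filter (fun m ↦ all = true ∨ kcert < m),
              (1 / Real.log ((N1Of P / m : ℕ) : ℝ)) * ((m : ℝ))⁻¹ +
            jumpRealFrom P K k' (fun m ↦ all = true ∨ kcert < m) := by
        unfold jumpRealFrom
        rw [← Finset.sum_union]
        · congr 1
          rw [← Finset.filter_union, Finset.Ico_union_Ico_eq_Ico hkk'.le hk'K]
        · exact Finset.disjoint_filter_filter (Finset.Ico_disjoint_Ico_consecutive _ _ _)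
      have hnn : ∀ m : ℕ, 0 ≤ (1 / Real.log ((N1Of P / m : ℕ) : ℝ)) * ((m : ℝ))⁻¹ := fun m ↦
        mul_nonneg (div_nonneg zero_le_one (Real.log_natCast_nonneg _)) (by positivity)
      cases hskip : (!all && Nat.ble (k' - 1) kcert)
      · rw [hskip] at h
        simp only [Bool.cond_false] at h
        split at h
        · rename_i L hL
          cases hlo : decide (L.lo ≤ 0)
          · rw [hlo] at h
            simp only [Bool.cond_false, le_refl, decide_true, Bool.cond_true] at h
            have hLpos : 0 < L.lo := by
              by_contra hle; push Not at hle
              have : decide (L.lo ≤ 0) = true := by simpa using hle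
              rw [hlo] at this; simp at this
            -- the recursive call
            have ih := jumpGo_sound P K kcert all fuel k' _ J h (by omega)
            -- the group bound
            have hq : FI.mem (Real.log ((N1Of P / k' : ℕ) : ℝ)) L := mem_logFI hL
            rw [FI.mem_def] at hq
            have hsc : (0 : ℝ) < SC := SC_pos
            have hLpos' : (0 : ℝ) < L.lo := by exact_mod_cast hLpos
            have hlogq : (L.lo : ℝ) / SC ≤ Real.log ((N1Of P / k' : ℕ) : ℝ) := by
              rw [div_le_iff₀ hsc]; exact hq.1
            have hlogq0 : 0 < Real.log ((N1Of P / k' : ℕ) : ℝ) := lt_of_lt_of_le (by positivity) hlogq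
            have hk0 : (0 : ℝ) < k := by exact_mod_cast (show 0 < k by omega)
            have hgroup : (∑ m ∈ (Finset.Ico k k').filter (fun m ↦ all = true ∨ kcert < m),
                (1 / Real.log ((N1Of P / m : ℕ) : ℝ)) * ((m : ℝ))⁻¹) * SC ≤
                ((cdiv (((k' : ℤ) - k) * SCZ * SCZ) ((k : ℤ) * L.lo) : ℤ) : ℝ) := by
              -- each term is at most `(SC/L.lo)/k`
              have hterm : ∀ m ∈ (Finset.Ico k k').filter (fun m ↦ all = true ∨ kcert < m),
                  (1 / Real.log ((N1Of P / m : ℕ) : ℝ)) * ((m : ℝ))⁻¹ ≤ (SC / L.lo) * ((k : ℝ))⁻¹ := by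
                intro m hm
                rw [Finset.mem_filter, Finset.mem_Ico] at hm
                have hm0 : 0 < m := by omega
                have hqm : (N1Of P / k' : ℕ) ≤ N1Of P / m := Nat.div_le_div_left (by omega) hm0
                have hlogm : Real.log ((N1Of P / k' : ℕ) : ℝ) ≤ Real.log ((N1Of P / m : ℕ) : ℝ) :=
                  Real.log_le_log (by
                    have : (1 : ℝ) ≤ ((N1Of P / k' : ℕ) : ℝ) := by
                      by_contra hlt; push Not at hlt
                      have h0' : (N1Of P / k' : ℕ) < 1 := by exact_mod_cast hlt
                      have h0 : (N1Of P / k' : ℕ) = 0 := Nat.lt_one_iff.mp h0'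
                      rw [h0] at hlogq0; simp at hlogq0
                    linarith) (by exact_mod_cast hqm)
                refine mul_le_mul ?_ (inv_anti₀ hk0 (by exact_mod_cast hm.1.1)) (by positivity) (by positivity)
                rw [div_le_div_iff₀ (lt_of_lt_of_le hlogq0 hlogm) hLpos']
                have := hlogq.trans hlogm
                rw [div_le_iff₀ hsc] at this
                linarith
              have hcard : ((Finset.Ico k k').filter (fun m ↦ all = true ∨ kcert < m)).card ≤ k' - k :=
                (Finset.card_filter_le _ _).trans (by simp)
              refine le_cast_cdiv (mul_pos (by exact_mod_cast (show (0 : ℤ) < k by omega)) hLpos) ?_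
              push_cast
              rw [SCZ_cast]
              calc (∑ m ∈ (Finset.Ico k k').filter (fun m ↦ all = true ∨ kcert < m),
                    (1 / Real.log ((N1Of P / m : ℕ) : ℝ)) * ((m : ℝ))⁻¹) * SC * ((k : ℝ) * L.lo)
                  ≤ (((Finset.Ico k k').filter (fun m ↦ all = true ∨ kcert < m)).card •
                      ((SC / L.lo) * ((k : ℝ))⁻¹)) * SC * ((k : ℝ) * L.lo) := by
                    gcongr
                    exact Finset.sum_le_card_nsmul _ _ _ hterm
                _ ≤ (((k' - k : ℕ) : ℝ) * ((SC / L.lo) * ((k : ℝ))⁻¹)) * SC * ((k : ℝ) * L.lo) := by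
                    rw [nsmul_eq_mul]
                    have : (((Finset.Ico k k').filter (fun m ↦ all = true ∨ kcert < m)).card : ℝ) ≤
                        ((k' - k : ℕ) : ℝ) := by exact_mod_cast hcard
                    gcongr
                _ = ((k' : ℝ) - k) * SC * SC := by
                    rw [Nat.cast_sub hkk'.le]
                    field_simp
            rw [hsplit]
            push_cast at ih
            nlinarith [ih, hgroup]
          · rw [hlo] at h
            simp at h
        · simp at h
      · -- skipped group: all its `m` are `≤ kcert` and `all = false`
        rw [hskip] at h
        simp only [Bool.cond_true] at h
        have ih := jumpGo_sound P K kcert all fuel k' acc J h (by omega)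
        rw [Bool.and_eq_true, Bool.not_eq_true', Nat.ble_eq] at hskip
        have hzero : ∑ m ∈ (Finset.Ico k k').filter (fun m ↦ all = true ∨ kcert < m),
            (1 / Real.log ((N1Of P / m : ℕ) : ℝ)) * ((m : ℝ))⁻¹ = 0 := by
          refine Finset.sum_eq_zero fun m hm ↦ ?_
          rw [Finset.mem_filter, Finset.mem_Ico] at hm
          rcases hm.2 with h1 | h2
          · rw [hskip.1] at h1; simp at h1
          · omega
        rw [hsplit, hzero, zero_add]
        exact ih
    · rw [hK] at h
      simp only [Bool.cond_true, Option.some.injEq] at h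
      subst h
      have hKk : K < k := by simpa [Nat.blt_eq] using hK
      have : jumpRealFrom P K k (fun m ↦ all = true ∨ kcert < m) = 0 := by
        unfold jumpRealFrom
        rw [Finset.Ico_eq_empty (by omega)]
        simp
      rw [this]; simp

/-- **`jumpSum`.** [folklore] -/
theorem jumpSum_sound (P : WinParams) {K kcert : ℕ} {all : Bool} {J : ℤ}
    (h : jumpSum (N1Of P) K kcert all = some J) :
    jumpReal P K (fun m ↦ all = true ∨ kcert < m) * SC ≤ (J : ℝ) := by
  have := jumpGo_sound P K kcert all _ 2 0 J h (by norm_num)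
  simp only [Int.cast_zero, zero_add] at this
  unfold jumpRealFrom at this
  unfold jumpReal
  rw [Finset.Ico_add_one_right_eq_Icc] at this
  exact this

/-- `J_all`. [folklore] -/
theorem jumpSum_all (P : WinParams) {K kcert : ℕ} {J : ℤ} (h : jumpSum (N1Of P) K kcert true = some J) :
    jumpReal P K (fun _ ↦ True) * SC ≤ (J : ℝ) := by
  have := jumpSum_sound P h
  unfold jumpReal at this ⊢
  rw [Finset.filter_true_of_mem (fun _ _ ↦ trivial)]
  rw [Finset.filter_true_of_mem (fun _ _ ↦ Or.inl rfl)] at this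
  exact this

/-- `J⁺`. [folklore] -/
theorem jumpSum_plus (P : WinParams) {K kcert : ℕ} {J : ℤ} (h : jumpSum (N1Of P) K kcert false = some J) :
    jumpReal P K (fun m ↦ kcert < m) * SC ≤ (J : ℝ) := by
  have := jumpSum_sound P h
  unfold jumpReal at this ⊢
  rw [Finset.filter_congr (q := fun m ↦ kcert < m) (fun _ _ ↦ by simp)] at this
  exact this

/-! ### The quantities of the criterion for the phases `ω(n) = n^{-iτ}` -/

section Criterion

variable (P : WinParams)

/-- The phases `ω(n) = n^{-iτ}` (a completely multiplicative function of `n ≥ 1`). [folklore] -/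
def ωOf (n : ℕ) : ℂ := phase (τOf P) (Real.log n)

/-- The fixed primes: those `≤ Y' = g_{i_Y}`. [folklore] -/
def SOf : Finset ℕ := (Finset.range (gridPt P.iY + 1)).filter Nat.Prime

/-- `a_ω(n) = ω(n)` for `n ≥ 1`. [folklore] -/
theorem complMul_ωOf {n : ℕ} (hn : 1 ≤ n) : complMul (ωOf P) n = ωOf P n := by
  induction n using Nat.recOnMul with
  | zero => omega
  | one => simp [ωOf, phase]
  | prime p hp => exact complMul_prime _ hp
  | mul a b ha hb =>
    have ha0 : a ≠ 0 := by rintro rfl; simp at hn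
    have hb0 : b ≠ 0 := by rintro rfl; simp at hn
    rw [map_mul, ha (Nat.pos_of_ne_zero ha0), hb (Nat.pos_of_ne_zero hb0)]
    unfold ωOf
    push_cast
    rw [Real.log_mul (by exact_mod_cast ha0) (by exact_mod_cast hb0), phase_add]

/-- `‖ω(n)‖ = 1`. [folklore] -/
theorem norm_ωOf (n : ℕ) : ‖ωOf P n‖ = 1 := norm_phase _ _

/-- `a_ω(m)·m^{-1} = m^{-s}`. [folklore] -/
theorem complMul_ωOf_mul_inv {m : ℕ} (hm : 1 ≤ m) :
    complMul (ωOf P) m * (m : ℂ) ^ (-((1 : ℝ) : ℂ)) = (m : ℂ) ^ (-(sOf (τOf P))) := by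
  rw [complMul_ωOf P hm, natCast_cpow_neg_sOf (by omega)]
  unfold ωOf
  push_cast
  rw [Complex.cpow_neg_one, mul_comm]

/-- **`c_p(1) = H_{⌊N/p⌋}(s)/p`.** [folklore] -/
theorem bigCoeff_ωOf (N p : ℕ) :
    bigCoeff N (ωOf P) p 1 = ((p : ℂ))⁻¹ * zetaPartialSum (N / p) (sOf (τOf P)) := by
  unfold bigCoeff zetaPartialSum
  rw [Finset.mul_sum]
  refine Finset.sum_congr rfl fun m hm ↦ ?_
  rw [Finset.mem_Icc] at hm
  rw [← complMul_ωOf_mul_inv P hm.1]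
  push_cast
  rw [Complex.cpow_neg_one, Complex.cpow_neg_one, mul_inv]
  ring

/-- `‖c_p(1)‖ = |H_{⌊N/p⌋}|/p`. [folklore] -/
theorem norm_bigCoeff_ωOf (N p : ℕ) :
    ‖bigCoeff N (ωOf P) p 1‖ = ‖zetaPartialSum (N / p) (sOf (τOf P))‖ / p := by
  rw [bigCoeff_ωOf P N p, norm_mul, norm_inv]
  simp only [Complex.norm_natCast]
  rw [inv_mul_eq_div]

/-- The free primes of `N ≥ Y'` are the primes of `(Y', N]`. [folklore] -/
theorem freePrimes_eq_binPrimes {N : ℕ} (hN : gridPt P.iY ≤ N) :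
    freePrimes N (SOf P) = binPrimes (gridPt P.iY) N := by
  ext p
  rw [mem_freePrimes]
  simp only [SOf, binPrimes, Finset.mem_filter, Finset.mem_range, Finset.mem_Ioc]
  constructor
  · rintro ⟨⟨h1, h2⟩, hp, hS⟩
    refine ⟨⟨?_, h2⟩, hp⟩
    by_contra hle
    exact hS ⟨by omega, hp⟩
  · rintro ⟨⟨h1, h2⟩, hp⟩
    have _ := hN
    exact ⟨⟨hp.one_lt.le, h2⟩, hp, fun h ↦ by omega⟩

/-- **The decomposition** `B(N) = H_N(s) − ∑_{p free} p^{-s} H_{⌊N/p⌋}(s)`. [folklore] -/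
theorem smoothSum_ωOf {N : ℕ} (hN : N < (gridPt P.iY + 1) * (gridPt P.iY + 1)) :
    smoothSum N (SOf P) (ωOf P) 1 =
      zetaPartialSum N (sOf (τOf P)) -
        ∑ p ∈ freePrimes N (SOf P), (p : ℂ) ^ (-(sOf (τOf P))) * zetaPartialSum (N / p) (sOf (τOf P)) := by
  have hSall : ∀ p : ℕ, p.Prime → p * p ≤ N → p ∈ SOf P := by
    intro p hp hpp
    simp only [SOf, Finset.mem_filter, Finset.mem_range]
    refine ⟨?_, hp⟩
    by_contra hlt
    have : gridPt P.iY + 1 ≤ p := by omega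
    have := Nat.mul_le_mul this this
    omega
  have hdec := twistedPartialSum_decomposition (S := SOf P) hSall (ω := ωOf P) (φ := ωOf P)
    (fun _ _ ↦ rfl) ((1 : ℝ) : ℂ) N le_rfl
  -- identify the three sums
  have hL : ∑ k ∈ Finset.Icc 1 N, complMul (ωOf P) k * (k : ℂ) ^ (-((1 : ℝ) : ℂ)) =
      zetaPartialSum N (sOf (τOf P)) := by
    unfold zetaPartialSum
    exact Finset.sum_congr rfl fun k hk ↦ by
      rw [Finset.mem_Icc] at hk; exact complMul_ωOf_mul_inv P hk.1
  have hB : ∑ k ∈ (Finset.Icc 1 N).filter (fun k ↦ k.primeFactors ⊆ SOf P),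
      complMul (ωOf P) k * (k : ℂ) ^ (-((1 : ℝ) : ℂ)) = smoothSum N (SOf P) (ωOf P) 1 := rfl
  have hC : ∀ r ∈ freePrimes N (SOf P),
      ωOf P r * ∑ m ∈ Finset.Icc 1 (N / r), complMul (ωOf P) m * ((m * r : ℕ) : ℂ) ^ (-((1 : ℝ) : ℂ)) =
        (r : ℂ) ^ (-(sOf (τOf P))) * zetaPartialSum (N / r) (sOf (τOf P)) := by
    intro r hr
    have hr0 : 0 < r := (mem_freePrimes.1 hr).2.1.pos
    have : ∑ m ∈ Finset.Icc 1 (N / r), complMul (ωOf P) m * ((m * r : ℕ) : ℂ) ^ (-((1 : ℝ) : ℂ)) =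
        bigCoeff N (ωOf P) r 1 := rfl
    rw [this, bigCoeff_ωOf P N r, natCast_cpow_neg_sOf hr0, ← mul_assoc]
    unfold ωOf
    rw [mul_comm (phase _ _)]
  rw [hL, hB, Finset.sum_congr rfl hC] at hdec
  rw [hdec]; ring

/-- The drift of `B`: `‖B(N) − B(N₁)‖ ≤ ∑_{N₁<n≤N} 1/n`. [folklore] -/
theorem norm_smoothSum_sub_le {N N1 : ℕ} (h : N1 ≤ N) :
    ‖smoothSum N (SOf P) (ωOf P) 1 - smoothSum N1 (SOf P) (ωOf P) 1‖ ≤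
      ∑ n ∈ Finset.Ioc N1 N, ((n : ℝ))⁻¹ := by
  unfold smoothSum
  have hsplit : (Finset.Icc 1 N).filter (fun n ↦ n.primeFactors ⊆ SOf P) =
      (Finset.Icc 1 N1).filter (fun n ↦ n.primeFactors ⊆ SOf P) ∪
        (Finset.Ioc N1 N).filter (fun n ↦ n.primeFactors ⊆ SOf P) := by
    rw [← Finset.filter_union]
    congr 1
    ext n; simp only [Finset.mem_Icc, Finset.mem_union, Finset.mem_Ioc]; omega
  rw [hsplit, Finset.sum_union (by
    rw [Finset.disjoint_left]
    intro n h1 h2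
    rw [Finset.mem_filter, Finset.mem_Icc] at h1
    rw [Finset.mem_filter, Finset.mem_Ioc] at h2
    omega), add_sub_cancel_left]
  refine (norm_sum_le _ _).trans ?_
  refine (Finset.sum_le_sum_of_subset_of_nonneg (Finset.filter_subset _ _) (fun _ _ _ ↦ norm_nonneg _)).trans ?_
  refine Finset.sum_le_sum fun n hn ↦ ?_
  rw [Finset.mem_Ioc] at hn
  rw [complMul_ωOf_mul_inv P (by omega)]
  have := norm_ofReal_cpow_neg (sOf_re (τOf P)) (show (0 : ℝ) < (n : ℝ) by exact_mod_cast (by omega : 0 < n))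
  rw [show ((n : ℝ) : ℂ) = (n : ℂ) by norm_cast] at this
  rw [this]

/-- `∑_{N₁<n≤N} 1/n ≤ (N − N₁)/(N₁ + 1)` (`N₁ ≤ N`). [folklore] -/
theorem sum_Ioc_inv_le {N1 N : ℕ} (h : N1 ≤ N) :
    ∑ n ∈ Finset.Ioc N1 N, ((n : ℝ))⁻¹ ≤ ((N : ℝ) - N1) / ((N1 : ℝ) + 1) := by
  calc ∑ n ∈ Finset.Ioc N1 N, ((n : ℝ))⁻¹ ≤ ∑ _n ∈ Finset.Ioc N1 N, ((N1 : ℝ) + 1)⁻¹ := by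
        refine Finset.sum_le_sum fun n hn ↦ ?_
        rw [Finset.mem_Ioc] at hn
        exact inv_anti₀ (by positivity) (by exact_mod_cast hn.1)
    _ = ((N : ℝ) - N1) / ((N1 : ℝ) + 1) := by
        rw [Finset.sum_const, Nat.card_Ioc, nsmul_eq_mul, Nat.cast_sub h]; ring

/-- **Double counting for the drift of `R`.** For `N < (Y+1)²` and `N₁ ≤ N`:
`∑_{p ∈ (Y, N₁] prime} (1/p) ∑_{⌊N₁/p⌋ < m ≤ ⌊N/p⌋} 1/m ≤ ∑_{N₁ < n ≤ N} 1/n` (the products `pm`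
are distinct integers of `(N₁, N]`). [folklore] -/
theorem sum_drift_pairs_le {Y N1 N : ℕ} (hN : N < (Y + 1) * (Y + 1)) :
    ∑ p ∈ binPrimes Y N1, ((p : ℝ))⁻¹ * ∑ m ∈ Finset.Ioc (N1 / p) (N / p), ((m : ℝ))⁻¹ ≤
      ∑ n ∈ Finset.Ioc N1 N, ((n : ℝ))⁻¹ := by
  rw [Finset.sum_congr rfl fun p _ ↦ Finset.mul_sum _ _ _, Finset.sum_sigma']
  set T := (binPrimes Y N1).sigma fun p ↦ Finset.Ioc (N1 / p) (N / p)
  have hprime : ∀ x ∈ T, x.1.Prime ∧ Y < x.1 ∧ N1 < x.2 * x.1 ∧ x.2 * x.1 ≤ N := by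
    intro x hx
    simp only [T, Finset.mem_sigma, binPrimes, Finset.mem_filter, Finset.mem_Ioc] at hx
    obtain ⟨⟨⟨h1, _⟩, hp⟩, h3, h4⟩ := hx
    exact ⟨hp, h1, (Nat.div_lt_iff_lt_mul (by omega)).1 h3, (Nat.le_div_iff_mul_le (by omega)).1 h4⟩
  have hinj : Set.InjOn (fun x : (Σ _ : ℕ, ℕ) ↦ x.2 * x.1) T := by
    intro x hx y hy hxy
    obtain ⟨hxp, hxY, hxN1, hxN⟩ := hprime x hx
    obtain ⟨hyp, hyY, hyN1, hyN⟩ := hprime y hy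
    simp only at hxy
    have hy2 : 0 < y.2 := by
      rcases Nat.eq_zero_or_pos y.2 with h0 | h0
      · rw [h0] at hyN1; simp at hyN1
      · exact h0
    have hp : x.1 = y.1 := by
      by_contra hne
      have hdvd : x.1 ∣ y.2 * y.1 := ⟨x.2, by rw [← hxy]; ring⟩
      rcases (Nat.Prime.dvd_mul hxp).1 hdvd with h | h
      · have hle : x.1 ≤ y.2 := Nat.le_of_dvd hy2 h
        have : (Y + 1) * (Y + 1) ≤ y.2 * y.1 := Nat.mul_le_mul (by omega) (by omega)
        omega
      · exact hne ((Nat.prime_dvd_prime_iff_eq hxp hyp).1 h)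
    have hm : x.2 = y.2 := by
      rw [hp] at hxy
      exact Nat.eq_of_mul_eq_mul_right hyp.pos hxy
    exact Sigma.ext hp (heq_of_eq hm)
  set g : (Σ _ : ℕ, ℕ) → ℕ := fun x ↦ x.2 * x.1 with hg
  have hval : ∀ x ∈ T, ((x.1 : ℝ))⁻¹ * ((x.2 : ℝ))⁻¹ = ((g x : ℝ))⁻¹ := fun x _ ↦ by
    simp only [hg]; push_cast; rw [mul_inv, mul_comm]
  calc ∑ x ∈ T, ((x.1 : ℝ))⁻¹ * ((x.2 : ℝ))⁻¹
      = ∑ x ∈ T, ((g x : ℝ))⁻¹ := Finset.sum_congr rfl hval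
    _ = ∑ n ∈ T.image g, ((n : ℝ))⁻¹ := (Finset.sum_image (f := fun n : ℕ ↦ ((n : ℝ))⁻¹) hinj).symm
    _ ≤ ∑ n ∈ Finset.Ioc N1 N, ((n : ℝ))⁻¹ := by
        refine Finset.sum_le_sum_of_subset_of_nonneg ?_ (fun _ _ _ ↦ by positivity)
        intro n hn
        rw [Finset.mem_image] at hn
        obtain ⟨x, hx, rfl⟩ := hn
        obtain ⟨-, -, h3, h4⟩ := hprime x hx
        rw [Finset.mem_Ioc]; exact ⟨h3, h4⟩

/-- **Drift of `R`.** `∑_{p∈(Y,N₁]} |H_{⌊N₁/p⌋}|/p ≤ ∑_{p∈(Y,N]} |H_{⌊N/p⌋}|/p + (N − N₁)/(N₁+1)`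
(`N₁ ≤ N < (Y+1)²`). [folklore] -/
theorem R_drift {Y N1 N : ℕ} (hN1 : N1 ≤ N) (hN : N < (Y + 1) * (Y + 1)) :
    ∑ p ∈ binPrimes Y N1, ‖zetaPartialSum (N1 / p) (sOf (τOf P))‖ / p ≤
      ∑ p ∈ binPrimes Y N, ‖zetaPartialSum (N / p) (sOf (τOf P))‖ / p + ((N : ℝ) - N1) / ((N1 : ℝ) + 1) := by
  set s := sOf (τOf P)
  have hsub : binPrimes Y N1 ⊆ binPrimes Y N := by
    intro p hp
    simp only [binPrimes, Finset.mem_filter, Finset.mem_Ioc] at hp ⊢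
    exact ⟨⟨hp.1.1, hp.1.2.trans hN1⟩, hp.2⟩
  have h1 : ∑ p ∈ binPrimes Y N1, ‖zetaPartialSum (N / p) s‖ / p ≤
      ∑ p ∈ binPrimes Y N, ‖zetaPartialSum (N / p) s‖ / p :=
    Finset.sum_le_sum_of_subset_of_nonneg hsub fun _ _ _ ↦ by positivity
  have h2 : ∑ p ∈ binPrimes Y N1, ‖zetaPartialSum (N1 / p) s‖ / p ≤
      ∑ p ∈ binPrimes Y N1, ‖zetaPartialSum (N / p) s‖ / p +
        ∑ p ∈ binPrimes Y N1, ((p : ℝ))⁻¹ * ∑ m ∈ Finset.Ioc (N1 / p) (N / p), ((m : ℝ))⁻¹ := by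
    rw [← Finset.sum_add_distrib]
    refine Finset.sum_le_sum fun p hp ↦ ?_
    simp only [binPrimes, Finset.mem_filter, Finset.mem_Ioc] at hp
    have hp0 : (0 : ℝ) < p := by exact_mod_cast (show 0 < p by omega)
    have hle : N1 / p ≤ N / p := Nat.div_le_div_right hN1
    have hd := norm_zetaPartialSum_sub_le_sum (sOf_re (τOf P)) hle
    have htri : ‖zetaPartialSum (N1 / p) s‖ ≤ ‖zetaPartialSum (N / p) s‖ +
        ‖zetaPartialSum (N / p) s - zetaPartialSum (N1 / p) s‖ := by
      have := norm_sub_norm_le (zetaPartialSum (N1 / p) s) (zetaPartialSum (N / p) s)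
      rw [← norm_sub_rev] at this
      linarith
    have hsum : ‖zetaPartialSum (N1 / p) s‖ ≤ ‖zetaPartialSum (N / p) s‖ +
        ∑ m ∈ Finset.Ioc (N1 / p) (N / p), ((m : ℝ))⁻¹ := by linarith
    calc ‖zetaPartialSum (N1 / p) s‖ / p
        ≤ (‖zetaPartialSum (N / p) s‖ + ∑ m ∈ Finset.Ioc (N1 / p) (N / p), ((m : ℝ))⁻¹) / p :=
          div_le_div_of_nonneg_right hsum hp0.le
      _ = _ := by rw [add_div, div_eq_inv_mul (∑ m ∈ Finset.Ioc (N1 / p) (N / p), ((m : ℝ))⁻¹) (p : ℝ)]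
  linarith [sum_drift_pairs_le (N1 := N1) hN, h1, h2, sum_Ioc_inv_le hN1]

/-- **The second condition.** For a free prime `p ∈ (Y, N]`, `N ≤ N₂`:
`2|H_{⌊N/p⌋}|/p ≤ 2(1 + log N₂)/(Y+1)`. [folklore] -/
theorem two_bigCoeff_le {Y N N2 p : ℕ} (hp : p ∈ binPrimes Y N) (hN : N ≤ N2) :
    2 * (‖zetaPartialSum (N / p) (sOf (τOf P))‖ / p) ≤ 2 * (1 + Real.log N2) / ((Y : ℝ) + 1) := by
  simp only [binPrimes, Finset.mem_filter, Finset.mem_Ioc] at hp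
  have hp1 : (Y : ℝ) + 1 ≤ p := by exact_mod_cast hp.1.1
  have hY0 : (0 : ℝ) < (Y : ℝ) + 1 := by positivity
  have hH := norm_zetaPartialSum_le (sOf_re (τOf P)) (N / p)
  have hlog : Real.log ((N / p : ℕ) : ℝ) ≤ Real.log N2 := by
    rcases Nat.eq_zero_or_pos (N / p) with h0 | h0
    · rw [h0]; simp only [Nat.cast_zero, Real.log_zero]; exact Real.log_natCast_nonneg _
    · exact Real.log_le_log (by exact_mod_cast h0) (by exact_mod_cast (Nat.div_le_self N p).trans hN)
  rw [mul_div_assoc]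
  refine mul_le_mul_of_nonneg_left ?_ (by norm_num)
  rw [div_le_div_iff₀ (by linarith) hY0]
  have h1 : ‖zetaPartialSum (N / p) (sOf (τOf P))‖ ≤ 1 + Real.log N2 := hH.trans (by linarith)
  have h2 : 0 ≤ 1 + Real.log (N2 : ℝ) := by linarith [Real.log_natCast_nonneg N2]
  nlinarith [norm_nonneg (zetaPartialSum (N / p) (sOf (τOf P)))]

end Criterion

/-! ### The total cell sums over `(i_Y, i_1]` -/

/-- The boundary index between table and envelope cells. [folklore] -/
def bIdx (P : WinParams) (E : EnvConsts) : ℕ := if P.i1 ≤ E.iX then P.i1 else max E.iX P.iY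

/-- The boundary index lies in `[i_Y, i_1]`. [folklore] -/
theorem bIdx_mem (P : WinParams) (E : EnvConsts) (hY : P.iY < P.i1) :
    P.iY ≤ bIdx P E ∧ bIdx P E ≤ P.i1 := by
  unfold bIdx; split_ifs <;> constructor <;> omega

/-- **Totals.** With `b = bIdx`: the cells `(i_Y, b]` are table cells and `(b, i_1]` envelope cells, so
the five cell sums over `(i_Y, i_1]` are the corresponding prime/integer sums. [folklore] -/
theorem cells_total (P : WinParams) (E : EnvConsts) (hY : P.iY < P.i1) :
    (∑ i ∈ Finset.Ioc P.iY P.i1, cellR P E i =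
        ∑ p ∈ binPrimes (gridPt P.iY) (gridPt (bIdx P E)), tabTermR P p) ∧
    (∑ i ∈ Finset.Ioc P.iY P.i1, cellP P E i =
        ∑ p ∈ binPrimes (gridPt P.iY) (gridPt (bIdx P E)), tabTermP P p +
          ∑ n ∈ Finset.Ioc (gridPt (bIdx P E)) (N1Of P), envTermP P n) ∧
    (∑ i ∈ Finset.Ioc P.iY P.i1, cellm P E i = ∑ n ∈ Finset.Ioc (gridPt (bIdx P E)) (N1Of P), envTermm P n) ∧
    (∑ i ∈ Finset.Ioc P.iY P.i1, cellM P E i = ∑ n ∈ Finset.Ioc (gridPt (bIdx P E)) (N1Of P), envTermM P n) ∧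
    (∑ i ∈ Finset.Ioc P.iY P.i1, cellR2 P E i = ∑ n ∈ Finset.Ico (gridPt (bIdx P E)) (N1Of P), envTermR2 P n) := by
  obtain ⟨hb1, hb2⟩ := bIdx_mem P E hY
  set b := bIdx P E with hbdef
  have htab : ∀ i ∈ Finset.Ioc P.iY b, i ≤ E.iX := fun i hi ↦ by
    rw [Finset.mem_Ioc] at hi
    simp only [hbdef, bIdx] at hi
    split_ifs at hi <;> omega
  have henv : ∀ i ∈ Finset.Ioc b P.i1, ¬ i ≤ E.iX := fun i hi ↦ by
    rw [Finset.mem_Ioc] at hi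
    simp only [hbdef, bIdx] at hi
    split_ifs at hi <;> omega
  have hsplit : ∀ {β : Type} [AddCommMonoid β] (f : ℕ → β),
      ∑ i ∈ Finset.Ioc P.iY P.i1, f i = ∑ i ∈ Finset.Ioc P.iY b, f i + ∑ i ∈ Finset.Ioc b P.i1, f i :=
    fun f ↦ Ioc_split hb1 hb2 f
  unfold N1Of
  have zR := Finset.sum_eq_zero (s := Finset.Ioc b P.i1) (f := cellR P E) fun i hi ↦ by simp [cellR, henv i hi]
  have zm := Finset.sum_eq_zero (s := Finset.Ioc P.iY b) (f := cellm P E) fun i hi ↦ by simp [cellm, htab i hi]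
  have zM := Finset.sum_eq_zero (s := Finset.Ioc P.iY b) (f := cellM P E) fun i hi ↦ by simp [cellM, htab i hi]
  have zR2 := Finset.sum_eq_zero (s := Finset.Ioc P.iY b) (f := cellR2 P E) fun i hi ↦ by simp [cellR2, htab i hi]
  refine ⟨?_, ?_, ?_, ?_, ?_⟩
  · rw [hsplit, zR, add_zero, ← sum_cells_binPrimes hb1]
    exact Finset.sum_congr rfl fun i hi ↦ by simp [cellR, htab i hi]
  · rw [hsplit, ← sum_cells_binPrimes_C hb1, ← sum_cells_Ioc hb2]
    congr 1
    · exact Finset.sum_congr rfl fun i hi ↦ by simp [cellP, htab i hi]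
    · exact Finset.sum_congr rfl fun i hi ↦ by simp [cellP, henv i hi]
  · rw [hsplit, zm, zero_add, ← sum_cells_Ioc hb2]
    exact Finset.sum_congr rfl fun i hi ↦ by simp [cellm, henv i hi]
  · rw [hsplit, zM, zero_add, ← sum_cells_Ioc hb2]
    exact Finset.sum_congr rfl fun i hi ↦ by simp [cellM, henv i hi]
  · rw [hsplit, zR2, zero_add, ← sum_cells_Ico hb2]
    exact Finset.sum_congr rfl fun i hi ↦ by simp [cellR2, henv i hi]

/-- `sumOuts` passes only if every chunk passed. [folklore] -/
theorem sumOuts_ok : ∀ (outs : List ChunkOut) (acc : ChunkOut), (sumOuts outs acc).ok = true →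
    acc.ok = true ∧ ∀ o ∈ outs, o.ok = true
  | [], acc, h => ⟨by simpa [sumOuts] using h, fun o ho ↦ by simp at ho⟩
  | o :: rest, acc, h => by
    rw [sumOuts] at h
    obtain ⟨h1, h2⟩ := sumOuts_ok rest _ h
    simp only [Bool.and_eq_true] at h1
    exact ⟨h1.1, fun o' ho' ↦ by
      rcases List.mem_cons.1 ho' with rfl | hmem
      · exact h1.2
      · exact h2 o' hmem⟩

/-! ### The verdict -/

section Verdict

variable {P : WinParams} {E : EnvConsts}

/-- Meaning of `structOK`. [folklore] -/
theorem structOK_spec {outs : List ChunkOut} {o : ChunkOut} (h : structOK P E outs o = true) :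
    o.ok = true ∧ P.i1 < P.i2 ∧ P.iY < P.i1 ∧ gridPt P.i2 ≤ gridPt P.iY * gridPt P.iY ∧
    P.splits.getD 0 0 = P.i1 ∧ P.splits.getLastD 0 = P.iY ∧ outs.length + 1 = P.splits.length ∧
    0 < P.tn ∧ 0 < P.td ∧ 1 < P.k0 ∧ P.k0 ≤ gridPt P.i1 ∧ 0 < E.ed ∧ E.an ≤ E.ed ∧ E.ed ≤ E.bn ∧
    20 < gridPt P.iY ∧ 0 ≤ o.mainm ∧ 0 ≤ o.Rtab ∧ 0 ≤ o.GX ∧ 0 ≤ o.R2 ∧ 0 ≤ o.mainM := by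
  unfold structOK at h
  simp only [Bool.and_eq_true, Nat.blt_eq, Nat.ble_eq, Nat.beq_eq, decide_eq_true_eq] at h
  obtain ⟨⟨⟨⟨⟨⟨⟨⟨⟨⟨⟨⟨⟨⟨⟨⟨⟨⟨⟨h1, h2⟩, h3⟩, h4⟩, h5⟩, h6⟩, h7⟩, h8⟩, h9⟩, h10⟩, h11⟩, h12⟩, h13⟩, h14⟩,
    h15⟩, h16⟩, h17⟩, h18⟩, h19⟩, h20⟩ := h
  exact ⟨h1, h2, h3, h4, h5, h6, h7, h8, h9, h10, h11, h12, h13, h14, h15, h16, h17, h18, h19, h20⟩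

/-- Meaning of `envTerms`. [folklore] -/
theorem envTerms_spec {o : ChunkOut} {iLN1hi ER EP : ℤ} (h : envTerms P E o iLN1hi = some (ER, EP))
    (hed : 0 < E.ed) (han : E.an ≤ E.ed) (hbn : E.ed ≤ E.bn) (hmainM : 0 ≤ o.mainM) (htd : 0 < P.td) :
    (P.i1 ≤ E.iX → ER = 0 ∧ EP = 0) ∧
    (¬ P.i1 ≤ E.iX →
      (((E.ed : ℝ) - E.an) / E.ed * o.mainm +
          ((E.bn : ℝ) - E.an) / E.ed *
            (o.GX + jumpReal P (gridPt P.i1 / (gridPt E.iX + 1)) (fun m ↦ o.kcert < m) * SC) ≤ ER) ∧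
      (max (1 - (E.an : ℝ) / E.ed) ((E.bn : ℝ) / E.ed - 1) *
          (iLN1hi + o.GX + ‖sOf (τOf P)‖ * o.mainM + o.R2 +
            jumpReal P (gridPt P.i1 / (gridPt E.iX + 1)) (fun _ ↦ True) * SC) ≤ EP)) := by
  unfold envTerms at h
  cases htab : Nat.ble P.i1 E.iX
  · rw [htab] at h
    simp only [Bool.cond_false] at h
    have hnot : ¬ P.i1 ≤ E.iX := fun hle ↦ by
      have : Nat.ble P.i1 E.iX = true := by rw [Nat.ble_eq]; exact hle
      rw [htab] at this; simp at this
    refine ⟨fun hle ↦ absurd hle hnot, fun _ ↦ ?_⟩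
    split at h
    · rename_i Jall Jplus hJa hJp
      simp only [Option.some.injEq, Prod.mk.injEq] at h
      obtain ⟨rfl, rfl⟩ := h
      have hed' : (0 : ℝ) < E.ed := by exact_mod_cast hed
      have hedZ : (0 : ℤ) < E.ed := by exact_mod_cast hed
      have hJall := jumpSum_all P (by unfold N1Of; exact hJa)
      have hJplus := jumpSum_plus P (by unfold N1Of; exact hJp)
      have hba : (0 : ℝ) ≤ (E.bn : ℝ) - E.an := by
        have : (E.an : ℝ) ≤ E.bn := by exact_mod_cast han.trans hbn
        linarith
      have hea : (0 : ℝ) ≤ (E.ed : ℝ) - E.an := by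
        have : (E.an : ℝ) ≤ E.ed := by exact_mod_cast han
        linarith
      set Jpr := jumpReal P (gridPt P.i1 / (gridPt E.iX + 1)) (fun m ↦ o.kcert < m)
      set Jar := jumpReal P (gridPt P.i1 / (gridPt E.iX + 1)) (fun _ ↦ True)
      constructor
      · refine le_cast_cdiv hedZ ?_
        push_cast
        have h1 : ((E.bn : ℝ) - E.an) * (o.GX + Jpr * SC) ≤ ((E.bn : ℝ) - E.an) * (o.GX + Jplus) :=
          mul_le_mul_of_nonneg_left (by linarith) hba
        calc (((E.ed : ℝ) - E.an) / E.ed * o.mainm + ((E.bn : ℝ) - E.an) / E.ed * (o.GX + Jpr * SC)) * E.ed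
            = ((E.ed : ℝ) - E.an) * o.mainm + ((E.bn : ℝ) - E.an) * (o.GX + Jpr * SC) := by field_simp
          _ ≤ ((E.ed : ℝ) - E.an) * o.mainm + ((E.bn : ℝ) - E.an) * (o.GX + Jplus) := by linarith
      · refine le_cast_cdiv hedZ ?_
        push_cast
        have hη : max (1 - (E.an : ℝ) / E.ed) ((E.bn : ℝ) / E.ed - 1) * E.ed =
            max ((E.ed : ℝ) - E.an) ((E.bn : ℝ) - E.ed) := by
          rw [max_mul_of_nonneg _ _ hed'.le]
          congr 1 <;> field_simp
        have hηnn : 0 ≤ max ((E.ed : ℝ) - E.an) ((E.bn : ℝ) - E.ed) := le_trans hea (le_max_left _ _)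
        -- `‖s‖·mainM ≤ sM`
        have hsM : ‖sOf (τOf P)‖ * o.mainM ≤ ((cdiv ((absS P.tn P.td).hi * o.mainM) SCZ : ℤ) : ℝ) := by
          refine le_cast_cdiv (by norm_num [SCZ]) ?_
          rw [SCZ_cast]
          push_cast
          have hs := norm_sOf_le_absS_hi (tn := P.tn) htd
          have hM : (0 : ℝ) ≤ o.mainM := by exact_mod_cast hmainM
          calc ‖sOf (τOf P)‖ * o.mainM * SC = (‖sOf ((P.tn : ℝ) / P.td)‖ * SC) * o.mainM := by
                unfold τOf; ring
            _ ≤ ((absS P.tn P.td).hi : ℝ) * o.mainM := mul_le_mul_of_nonneg_right hs hM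
        calc max (1 - (E.an : ℝ) / E.ed) ((E.bn : ℝ) / E.ed - 1) *
              (iLN1hi + o.GX + ‖sOf (τOf P)‖ * o.mainM + o.R2 + Jar * SC) * E.ed
            = max ((E.ed : ℝ) - E.an) ((E.bn : ℝ) - E.ed) *
                (iLN1hi + o.GX + ‖sOf (τOf P)‖ * o.mainM + o.R2 + Jar * SC) := by
              rw [mul_comm _ (E.ed : ℝ), ← mul_assoc, mul_comm (E.ed : ℝ), hη]
          _ ≤ max ((E.ed : ℝ) - E.an) ((E.bn : ℝ) - E.ed) *
                (iLN1hi + o.GX + ((cdiv ((absS P.tn P.td).hi * o.mainM) SCZ : ℤ) : ℝ) + o.R2 + Jall) := by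
              refine mul_le_mul_of_nonneg_left ?_ hηnn
              linarith
          _ = _ := by ring
    · simp at h
  · rw [htab] at h
    simp only [Bool.cond_true, Option.some.injEq, Prod.mk.injEq] at h
    obtain ⟨rfl, rfl⟩ := h
    have hle : P.i1 ≤ E.iX := by simpa [Nat.ble_eq] using htab
    exact ⟨fun _ ↦ ⟨rfl, rfl⟩, fun hn ↦ absurd hle hn⟩

/-- `S ⊇ {p : p² ≤ N}` whenever `N < (Y'+1)²`. [folklore] -/
theorem mem_SOf_of_sq_le {N : ℕ} (hN : N < (gridPt P.iY + 1) * (gridPt P.iY + 1)) :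
    ∀ p : ℕ, p.Prime → p * p ≤ N → p ∈ SOf P := by
  intro p hp hpp
  simp only [SOf, Finset.mem_filter, Finset.mem_range]
  refine ⟨?_, hp⟩
  by_contra hlt
  have : gridPt P.iY + 1 ≤ p := by omega
  have := Nat.mul_le_mul this this
  omega

/-- `l.getD (l.length - 1) d = l.getLastD d`. [folklore] -/
theorem List.getD_length_sub_one_eq_getLastD {α : Type*} (l : List α) (d : α) :
    l.getD (l.length - 1) d = l.getLastD d := by
  rw [List.getLastD_eq_getLast?, List.getLast?_eq_getElem?, List.getD_eq_getElem?_getD]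

set_option maxHeartbeats 1600000 in
/-- **Soundness of the window checker.** If the combination of the chunk outputs passes
(`combine`), every listed output is the kernel value of its chunk, the prime-count table is correct up
to `i_X`, and `α n ≤ θ(n) ≤ β n` for `n ≥ X`, then `ζ_N(s) = 0` for some `s` with `Re s > 1`, for
EVERY `N ∈ [g_{i₁}, g_{i₂}]`. [cite: PlattTrudgian2016, §2] [cite: Montgomery1983, §2] -/
theorem window_sound (P : WinParams) (E : EnvConsts) (piTab : List ℕ) (outs : List ChunkOut)
    (hcomb : combine P E outs = true)
    (houts : ∀ c, c < outs.length → outs.getD c ChunkOut.fail = chunkOut P E piTab c)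
    (hpi : PiTabOK piTab E.iX) (hEnv : EnvHyp E) :
    ∀ N : ℕ, gridPt P.i1 ≤ N → N ≤ gridPt P.i2 → ∃ s : ℂ, 1 < s.re ∧ zetaPartialSum N s = 0 := by
  ------------------------------------------------------------------ A. the verdict
  unfold combine at hcomb
  split at hcomb
  rotate_left
  · simp at hcomb
  rename_i Rfin Bfin h2l mc hv
  simp only [Bool.and_eq_true, decide_eq_true_eq] at hcomb
  obtain ⟨⟨hBR, hh2R⟩, -⟩ := hcomb
  unfold verdict at hv
  dsimp only at hv
  set o := sumOuts outs initOut with hodef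
  cases hs : structOK P E outs o
  · rw [hs] at hv; simp at hv
  rw [hs] at hv
  simp only [Bool.not_true, Bool.cond_false] at hv
  obtain ⟨hok, hi12, hiY1, hN2Y, hs0, hslast, hlen, htn, htd, hk0, hk0N1, hed, han, hbn, hY20,
    hmainm0, hRtab0, hGX0, hR20, hmainM0⟩ := structOK_spec hs
  split at hv
  rotate_left
  · simp at hv
  rename_i L0 Ψ0 LN1 ΨN LN2 hp0 hpN1 hLN2
  split at hv
  rotate_left
  · simp at hv
  rename_i Babs iLN1 hBabs hiLN1
  split at hv
  · simp at hv
  rename_i ER EP henv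
  simp only [Option.some.injEq, Prod.mk.injEq] at hv
  obtain ⟨hRfin, hBfin, hh2l, -⟩ := hv
  ------------------------------------------------------------------ B. notation and basic facts
  set N1 := gridPt P.i1 with hN1def
  set N2 := gridPt P.i2 with hN2def
  set Y := gridPt P.iY with hYdef
  have hN1' : N1Of P = N1 := rfl
  have hY20' : 20 ≤ Y := twenty_le_gridPt _
  have hYN1 : Y < N1 := gridPt_strictMono hiY1
  have hN12 : N1 < N2 := gridPt_strictMono hi12
  have hsc : (0 : ℝ) < SC := SC_pos
  have hSCZ : (0 : ℤ) < SCZ := by norm_num [SCZ]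
  ------------------------------------------------------------------ C. every chunk passed
  obtain ⟨-, hoks⟩ := sumOuts_ok outs initOut hok
  have hokc : ∀ c, c < outs.length → (chunkOut P E piTab c).ok = true := by
    intro c hc
    rw [← houts c hc, List.getD_eq_getElem _ _ hc]
    exact hoks _ (List.getElem_mem hc)
  ------------------------------------------------------------------ D. `Hk0` from chunk 0
  have hlen0 : 0 < outs.length := by
    by_contra h0
    have h0' : outs.length = 0 := by omega
    rw [h0', zero_add] at hlen
    -- a one-element `splits` has equal first and last entries
    have : P.splits.getD 0 0 = P.splits.getLastD 0 := by
      rw [← List.getD_length_sub_one_eq_getLastD, ← hlen]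
    rw [hs0, hslast] at this
    omega
  have hHk0 : CB.mem (Hk P P.k0) P.Hk0 := by
    refine (chunkOut_sound (E := E) (piTab := piTab) (c := 0) htd (hokc 0 hlen0)).1 ?_
    rw [hs0]
    show gridPt P.i1 / gridPt P.i1 < P.k0
    rw [Nat.div_self (gridPt_pos _)]
    exact hk0
  have W : WinCtx P E piTab := ⟨htd, htn, by omega, hHk0, hpi⟩
  ------------------------------------------------------------------ E. the fold
  have hfold : FoldInv P E outs.length o := by
    have := sumOuts_sound W outs houts hokc 0 outs initOut (by simp) (foldInv_init P E hs0)
    simpa using this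
  have hlast : P.splits.getD outs.length 0 = P.iY := by
    rw [show outs.length = P.splits.length - 1 by omega, List.getD_length_sub_one_eq_getLastD, hslast]
  have hcells : CellBounds P E P.iY P.i1 o := by
    have := hfold.cells
    rw [hlast, hs0] at this
    exact this
  have hmono : MonoCert P o.kcert := hfold.mono
  ------------------------------------------------------------------ F. totals
  obtain ⟨hRsum, hPsum, hmsum, hMsum, hR2sum⟩ := cells_total P E hiY1
  obtain ⟨hbY, hb1⟩ := bIdx_mem P E hiY1
  set b := bIdx P E with hbdef
  set a := gridPt b with hadef
  have hYa : Y ≤ a := gridPt_strictMono.monotone hbY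
  have haN1 : a ≤ N1 := gridPt_strictMono.monotone hb1
  have ha20 : 20 ≤ a := twenty_le_gridPt _
  rw [hN1'] at hPsum hmsum hMsum hR2sum
  -- the reference sums at `N₁`
  set RN1 := ∑ p ∈ binPrimes Y N1, tabTermR P p with hRN1def
  set PN1 := ∑ p ∈ binPrimes Y N1, tabTermP P p with hPN1def
  have hRsplit : RN1 = ∑ p ∈ binPrimes Y a, tabTermR P p + ∑ p ∈ binPrimes a N1, tabTermR P p :=
    binPrimes_split hYa haN1 _
  have hPsplit : PN1 = ∑ p ∈ binPrimes Y a, tabTermP P p + ∑ p ∈ binPrimes a N1, tabTermP P p :=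
    binPrimes_split hYa haN1 _
  set Ediff := ∑ p ∈ binPrimes a N1, tabTermP P p - ∑ n ∈ Finset.Ioc a N1, envTermP P n with hEdef
  have hPN1cells : PN1 = ∑ i ∈ Finset.Ioc P.iY P.i1, cellP P E i + Ediff := by
    rw [hPsplit, hPsum, hEdef]; ring
  ------------------------------------------------------------------ G. envelope terms
  obtain ⟨henvT, henvE⟩ := envTerms_spec henv hed han hbn hmainM0 htd
  set α : ℝ := (E.an : ℝ) / E.ed
  set β : ℝ := (E.bn : ℝ) / E.ed
  have hα0 : 0 ≤ α := by positivity
  -- case analysis on the window position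
  have hRmain : (o.Rtab : ℝ) + o.mainm - ER ≤ RN1 * SC ∧ ‖Ediff‖ * SC ≤ EP := by
    by_cases htab : P.i1 ≤ E.iX
    · -- inside the table: `b = i1`, `a = N₁`, the envelope range is empty
      obtain ⟨hER, hEP⟩ := henvT htab
      have hb : b = P.i1 := by simp [hbdef, bIdx, htab]
      have ha : a = N1 := by rw [hadef, hb]
      have hm0 : (o.mainm : ℝ) ≤ 0 := by
        have := hcells.mainm
        rw [hmsum, ha, Finset.Ioc_self, Finset.sum_empty, zero_mul] at this
        exact this
      have hE0 : Ediff = 0 := by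
        rw [hEdef, ha]
        simp [binPrimes]
      refine ⟨?_, by rw [hE0, hEP]; simp⟩
      rw [hER]
      push_cast
      have h1 := hcells.Rtab
      rw [hRsum] at h1
      have h2 : ∑ p ∈ binPrimes Y a, tabTermR P p ≤ RN1 := by
        rw [hRsplit]
        have : 0 ≤ ∑ p ∈ binPrimes a N1, tabTermR P p :=
          Finset.sum_nonneg fun p _ ↦ by unfold tabTermR; positivity
        linarith
      nlinarith
    · -- the envelope range `(a, N₁]`, `a = g_{max(iX,iY)} ≥ X`
      obtain ⟨hER, hEP⟩ := henvE htab
      have hb : b = max E.iX P.iY := by simp [hbdef, bIdx, htab]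
      have hbi1 : b < P.i1 := by rw [hb]; exact max_lt (by omega) hiY1
      have haX : gridPt E.iX ≤ a := by rw [hadef, hb]; exact gridPt_strictMono.monotone (le_max_left _ _)
      have haN1' : a < N1Of P := by rw [hN1']; exact gridPt_strictMono hbi1
      have hK : kOf P (a + 1) ≤ gridPt P.i1 / (gridPt E.iX + 1) := by
        unfold kOf N1Of
        exact Nat.div_le_div_left (by omega) (by omega)
      -- `G·SC ≤ GX`
      have hG : ‖Hk P (kOf P (a + 1))‖ / Real.log ((a : ℝ) + 1) * SC ≤ (o.GX : ℝ) := by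
        have := hcells.GX (by rw [← hb]; exact hbY) (by rw [← hb]; exact hbi1)
        rw [← hb] at this
        exact this
      have hGnn : 0 ≤ ‖Hk P (kOf P (a + 1))‖ / Real.log ((a : ℝ) + 1) := by
        apply div_nonneg (norm_nonneg _)
        exact Real.log_nonneg (by linarith [show (20 : ℝ) ≤ a from by exact_mod_cast ha20])
      constructor
      · -- `R`
        have hlow := envelope_R_lower (P := P) hEnv haX (by omega) haN1' hmono hK (han.trans hbn) hed
        rw [hN1'] at hlow
        have hm := hcells.mainm
        rw [hmsum] at hm
        have hRt := hcells.Rtab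
        rw [hRsum] at hRt
        have hJnn : 0 ≤ jumpReal P (gridPt P.i1 / (gridPt E.iX + 1)) (fun m ↦ o.kcert < m) := by
          unfold jumpReal
          exact Finset.sum_nonneg fun m _ ↦ mul_nonneg (div_nonneg zero_le_one (Real.log_natCast_nonneg _))
            (by positivity)
        have hβα : 0 ≤ β - α := by
          simp only [α, β]
          rw [← sub_div]
          exact div_nonneg (by linarith [show (E.an : ℝ) ≤ E.bn from by exact_mod_cast han.trans hbn])
            (by positivity)
        -- combine
        have e1 : α * o.mainm ≤ α * ((∑ n ∈ Finset.Ioc a N1, envTermm P n) * SC) :=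
          mul_le_mul_of_nonneg_left hm hα0
        have e2 : (β - α) * (‖Hk P (kOf P (a + 1))‖ / Real.log ((a : ℝ) + 1) * SC) ≤ (β - α) * o.GX :=
          mul_le_mul_of_nonneg_left hG hβα
        have e3 := mul_le_mul_of_nonneg_left hlow hsc.le
        rw [hRsplit]
        have : ((E.ed : ℝ) - E.an) / E.ed = 1 - α := by
          simp only [α]; field_simp
        rw [this] at hER
        have : ((E.bn : ℝ) - E.an) / E.ed = β - α := by
          simp only [α, β]; field_simp
        rw [this] at hER
        nlinarith [e1, e2, e3, hER, hRt]
      · -- `Ediff`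
        have herr := envelope_P_error (P := P) hEnv haX (by omega) haN1' hK
        rw [hN1'] at herr
        have hη0 : 0 ≤ max (1 - (E.an : ℝ) / E.ed) ((E.bn : ℝ) / E.ed - 1) := by
          refine le_trans ?_ (le_max_left _ _)
          rw [sub_nonneg, div_le_one (by exact_mod_cast hed)]
          exact_mod_cast han
        -- the pieces, scaled
        have hL : 1 / Real.log N1 * SC ≤ (iLN1.hi : ℝ) := by
          have hm := FI.mem_divPos hiLN1 (FI.mem_ofInt 1) (phasePt_spec htd hpN1).1
          rw [FI.mem_def] at hm
          push_cast at hm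
          exact hm.2
        have hM := hcells.mainM
        rw [hMsum] at hM
        have hR2 := hcells.R2
        rw [hR2sum] at hR2
        have hs0 : 0 ≤ ‖sOf (τOf P)‖ := norm_nonneg _
        calc ‖Ediff‖ * SC ≤ max (1 - (E.an : ℝ) / E.ed) ((E.bn : ℝ) / E.ed - 1) *
              (1 / Real.log N1 + ‖Hk P (kOf P (a + 1))‖ / Real.log ((a : ℝ) + 1) +
                ‖sOf (τOf P)‖ * ∑ n ∈ Finset.Ioc a N1, envTermM P n +
                ∑ n ∈ Finset.Ico a N1, envTermR2 P n +
                jumpReal P (gridPt P.i1 / (gridPt E.iX + 1)) (fun _ ↦ True)) * SC :=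
              mul_le_mul_of_nonneg_right herr hsc.le
          _ = max (1 - (E.an : ℝ) / E.ed) ((E.bn : ℝ) / E.ed - 1) *
              (1 / Real.log N1 * SC + ‖Hk P (kOf P (a + 1))‖ / Real.log ((a : ℝ) + 1) * SC +
                ‖sOf (τOf P)‖ * ((∑ n ∈ Finset.Ioc a N1, envTermM P n) * SC) +
                (∑ n ∈ Finset.Ico a N1, envTermR2 P n) * SC +
                jumpReal P (gridPt P.i1 / (gridPt E.iX + 1)) (fun _ ↦ True) * SC) := by ring
          _ ≤ max (1 - (E.an : ℝ) / E.ed) ((E.bn : ℝ) / E.ed - 1) *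
              (iLN1.hi + o.GX + ‖sOf (τOf P)‖ * o.mainM + o.R2 +
                jumpReal P (gridPt P.i1 / (gridPt E.iX + 1)) (fun _ ↦ True) * SC) := by
              refine mul_le_mul_of_nonneg_left ?_ hη0
              have := mul_le_mul_of_nonneg_left hM hs0
              linarith
          _ ≤ EP := hEP
  obtain ⟨hRmain, hEmain⟩ := hRmain
  ------------------------------------------------------------------ H. `B(N₁)` and the box
  have hHN1 : CB.mem (Hk P N1) (emBox P.tn P.td P.k0 P.Hk0 ΨN Ψ0) := by
    unfold Hk τOf
    exact mem_emBox htn htd (by omega) hk0N1 hHk0 (phasePt_spec htd hpN1).2 (phasePt_spec htd hp0).2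
  have hBabs' : ‖Hk P N1 - ∑ i ∈ Finset.Ioc P.iY P.i1, cellP P E i‖ * SC ≤ (Babs : ℝ) :=
    le_absHiCB hBabs (CB.mem_sub hHN1 hcells.P0)
  have hsqY : Y * Y < (gridPt P.iY + 1) * (gridPt P.iY + 1) := by
    rw [← hYdef]; exact Nat.mul_self_lt_mul_self (Nat.lt_succ_self Y)
  have hBN1 : smoothSum N1 (SOf P) (ωOf P) 1 = Hk P N1 - PN1 := by
    have hsq : N1 < (gridPt P.iY + 1) * (gridPt P.iY + 1) :=
      lt_of_le_of_lt (hN12.le.trans hN2Y) hsqY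
    rw [smoothSum_ωOf P hsq, freePrimes_eq_binPrimes P hYN1.le, hPN1def]
    unfold tabTermP Hk kOf
    rfl
  have hBN1norm : ‖smoothSum N1 (SOf P) (ωOf P) 1‖ * SC ≤ (Babs : ℝ) + EP := by
    rw [hBN1, hPN1cells, ← sub_sub]
    have := norm_sub_le (Hk P N1 - ∑ i ∈ Finset.Ioc P.iY P.i1, cellP P E i) Ediff
    nlinarith
  ------------------------------------------------------------------ I. the drift and `h2` constants
  have hΔ : ((N2 : ℝ) - N1) / ((N1 : ℝ) + 1) * SC ≤
      ((cdiv (((N2 : ℤ) - N1) * SCZ) ((N1 : ℤ) + 1) : ℤ) : ℝ) := by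
    refine le_cast_cdiv (by positivity) ?_
    push_cast
    rw [SCZ_cast]
    have : (0 : ℝ) < (N1 : ℝ) + 1 := by positivity
    exact le_of_eq (by field_simp)
  have hh2c : 2 * (1 + Real.log N2) / ((Y : ℝ) + 1) * SC ≤ (h2l : ℝ) := by
    rw [← hh2l]
    refine le_cast_cdiv (by positivity) ?_
    push_cast
    rw [SCZ_cast]
    have hL2 := mem_logFI hLN2
    rw [FI.mem_def] at hL2
    have hY0 : (0 : ℝ) < (Y : ℝ) + 1 := by positivity
    calc 2 * (1 + Real.log N2) / ((Y : ℝ) + 1) * SC * ((Y : ℝ) + 1) = 2 * (SC + Real.log N2 * SC) := by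
          field_simp
      _ ≤ 2 * (SC + LN2.hi) := by nlinarith [hL2.2]
  ------------------------------------------------------------------ J. every `N` of the window
  intro N hN1 hN2
  have hsqN : N < (gridPt P.iY + 1) * (gridPt P.iY + 1) := lt_of_le_of_lt (hN2.trans hN2Y) hsqY
  have hYN : Y ≤ N := hYN1.le.trans hN1
  -- the two sides of the criterion at `N`
  have hfree := freePrimes_eq_binPrimes P hYN
  set RN := ∑ p ∈ freePrimes N (SOf P), ‖bigCoeff N (ωOf P) p 1‖ with hRNdef
  have hRN : RN = ∑ p ∈ binPrimes Y N, ‖zetaPartialSum (N / p) (sOf (τOf P))‖ / p := by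
    rw [hRNdef, hfree]
    exact Finset.sum_congr rfl fun p _ ↦ norm_bigCoeff_ωOf P N p
  have hRN1eq : RN1 = ∑ p ∈ binPrimes Y N1, ‖zetaPartialSum (N1 / p) (sOf (τOf P))‖ / p := rfl
  have hdriftR : RN1 ≤ RN + ((N : ℝ) - N1) / ((N1 : ℝ) + 1) := by
    rw [hRN, hRN1eq]; exact R_drift (P := P) hN1 hsqN
  have hdriftB : ‖smoothSum N (SOf P) (ωOf P) 1‖ ≤
      ‖smoothSum N1 (SOf P) (ωOf P) 1‖ + ((N : ℝ) - N1) / ((N1 : ℝ) + 1) := by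
    have h1 := norm_smoothSum_sub_le P hN1
    have h2 := sum_Ioc_inv_le (N1 := N1) (N := N) hN1
    have h3 := norm_sub_norm_le (smoothSum N (SOf P) (ωOf P) 1) (smoothSum N1 (SOf P) (ωOf P) 1)
    linarith
  have hΔN : ((N : ℝ) - N1) / ((N1 : ℝ) + 1) ≤ ((N2 : ℝ) - N1) / ((N1 : ℝ) + 1) :=
    div_le_div_of_nonneg_right (by linarith [show (N : ℝ) ≤ N2 from by exact_mod_cast hN2]) (by positivity)
  -- `Rfin ≤ (RN)·SC`
  have hRfinR : (Rfin : ℝ) ≤ RN * SC := by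
    rw [← hRfin]; push_cast
    nlinarith [hRmain, hΔ, hdriftR, hΔN]
  refine exists_zero_of_criterion (S := SOf P) (ω := ωOf P) (mem_SOf_of_sq_le hsqN)
    (fun p _ _ ↦ norm_ωOf P p) ?_ ?_
  · -- h1
    have hlt : (Bfin : ℝ) < Rfin := by exact_mod_cast hBR
    have : ‖smoothSum N (SOf P) (ωOf P) 1‖ * SC ≤ Bfin := by
      rw [← hBfin]; push_cast
      nlinarith [hBN1norm, hΔ, hdriftB, hΔN]
    rw [← hRNdef]
    nlinarith
  · -- h2
    intro p hp
    rw [← hRNdef]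
    have hlt : (h2l : ℝ) < Rfin := by exact_mod_cast hh2R
    rw [hfree] at hp
    have := two_bigCoeff_le (P := P) (N2 := N2) hp hN2
    rw [norm_bigCoeff_ωOf P N p]
    nlinarith

end Verdict

end Literature.Barriers.RiemannHypothesis.TuranWindow
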